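/-
Copyright: harness tree, Literature layer (sorry-free). b2b-lace enum1-g52 (ENUMERATION SHARD A gen 52),
node KU-SEP-SEED-K2: soundness of the PRODUCT-ROW twisted SEEDCERT kernel evaluator.
-/
import Literature.Probability.FitznerVanDerHofstad2017.SrwTwistProdCertSemantics
import Literature.Probability.FitznerVanDerHofstad2017.SrwTwistSeedCertSound
import HarnessLib

/-!
# Product-row twisted SEEDCERT kernel: soundness of the evaluator

Companion of `SrwTwistProdCertKernel` (the computable layer) and `SrwTwistProdCertSemantics` (the
table layer), and generalisation of `SrwTwistSeedCertSound` from ONE twisted row `Ψ(u)^D` to a PRODUCT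
`Ψ_cls(u) = ∏_r Ψ_{a_r}(u)^{p_r}` (`Σ_r p_r = D`) of cos-power CLASS rows
`Ψ_a(u) = Σ_{j ≤ J} Σ_{s ≤ a} ε_j i^j (Q_j/qden) (C(a,s)/2^a) q_u(|jm + a - 2s|)`, `q_u(b) = e^{-u} I_b(u)`:
if `PrCert.checkP c D = true` then, for `1 ≤ n ≤ 4` and every coordinate assignment `a : Fin D → ℕ` that
unrolls the class list (`List.ofFn a = unroll c.cls`),
`lo n ≤ (1/(n-1)!) ∫₀^∞ τ^{n-1} e^{-τ} Re ∏_μ (Σ_{j ≤ J} ε_j (Σ_{s ≤ a_μ} C(a_μ,s) 2^{-a_μ} I_{jm-(2s-a_μ)}(τ/D)) c_j) dτ / (2π)^D ≤ hi n`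
with `c_j = 2π i^j Q_j/qden` — literally the per-row factor of the product-row object of
`SrwTwistProductSliceBudget` (`PrCert.soundP`, `PrCert.soundP_of_parts`).

The proof re-runs `SrwTwistSeedCertSound` with the power `(·)^D` replaced by the class-list fold `cfold`
(`∏_r (·)_{a_r}^{p_r}`): (6a) the two-sided `[0,T]` Poisson block for `F = prF cls`
(`hasSum_block0P`, `PrCert.ioc_blockP`: exact head `P_n - e^{-λ}U_n` from the product table via
`PrCert.PqP_real`, signed Poisson-tail remainder `R⁺_n` via `‖N![s^N]F‖ ≤ qden^D 2^A (2D)^N`);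
(6d) the literal identification (`rowLit2_eq_ublock`; the Bessel index `jm - (2s-a)` has `|·| = cosOrd`);
(6e) integrability and the split at `T = t²`; (6c) the `[T,∞)` block in ball form: per class the midpoint
brackets give `‖W_a(u) - P_a(1/u)‖ ≤ ρ w^{Jb+1}` and `‖P_a‖ ≤ α U_0 + ρ w^{Jb+1}` (`w = 1/u`; the SAME
`α, ρ` for every class since `Σ_s C(a,s) 2^{-a} = 1`), whence the fold perturbation
`|Re ∏ W - Re ∏ P| ≤ G₂^D - G₁^D` (`norm_cfold_sub_cfold_le`) with the single-row majorant lists `g₁, g₂`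
reused verbatim, and the main term is the kernel's `powRe2 = Re ∏_r (2^S qden 2^{a_r} P_{a_r})^{p_r}`
(`PrCert.powRe2_eval`).  Everything is stated for a general class list; number-free.
[cite: FitznerVanDerHofstad2016NoBLE, §5.1.1 (5.2)–(5.5) pp. 1089–1090]
-/

set_option Elab.async false

namespace Literature.Probability.FitznerVanDerHofstad2017.SeedCert

open Real MeasureTheory Set Finset
open Literature.Probability.LatticeModels (besselI srwHeatKernel)
open scoped Nat

/-! ### Part 0: class-list folds -/

section Folds

/-- The class-list fold `∏_r f(a_r)^{p_r}` (right-nested). [cite: FitznerVanDerHofstad2016NoBLE, §5.1.1 (5.4)–(5.5) pp. 1089–1090] -/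
def cfold {M : Type*} [Monoid M] (f : ℕ → M) : List (ℕ × ℕ) → M
  | [] => 1
  | (a, p) :: t => f a ^ p * cfold f t

/-- `cfold` on the empty class list. [cite: FitznerVanDerHofstad2016NoBLE, §5.1.1 (5.4)–(5.5) pp. 1089–1090] -/
@[simp] theorem cfold_nil {M : Type*} [Monoid M] (f : ℕ → M) : cfold f [] = 1 := rfl

/-- `cfold` on a cons. [cite: FitznerVanDerHofstad2016NoBLE, §5.1.1 (5.4)–(5.5) pp. 1089–1090] -/
@[simp] theorem cfold_cons {M : Type*} [Monoid M] (f : ℕ → M) (a p : ℕ) (t : List (ℕ × ℕ)) :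
    cfold f ((a, p) :: t) = f a ^ p * cfold f t := rfl

/-- `prFFun` is the fold of the class rows. [cite: FitznerVanDerHofstad2016NoBLE, §5.1.1 (5.4)–(5.5) pp. 1089–1090] -/
theorem prFFun_eq_cfold (m J : ℕ) (Q : ℕ → ℤ) (s : ℝ) :
    ∀ cls : List (ℕ × ℕ), prFFun m J Q s cls = cfold (fun a => twRowFun2 m J Q a s) cls
  | [] => rfl
  | (a, p) :: t => by rw [prFFun, cfold_cons, prFFun_eq_cfold m J Q s t]

/-- Congruence of the fold along the classes present. [cite: FitznerVanDerHofstad2016NoBLE, §5.1.1 (5.4)–(5.5) pp. 1089–1090] -/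
theorem cfold_congr {M : Type*} [Monoid M] {f g : ℕ → M} :
    ∀ cls : List (ℕ × ℕ), (∀ ap ∈ cls, f ap.1 = g ap.1) → cfold f cls = cfold g cls
  | [], _ => rfl
  | (a, p) :: t, h => by
      rw [cfold_cons, cfold_cons, h (a, p) List.mem_cons_self,
        cfold_congr t fun ap hap => h ap (List.mem_cons_of_mem _ hap)]

/-- The fold is multiplicative. [cite: FitznerVanDerHofstad2016NoBLE, §5.1.1 (5.4)–(5.5) pp. 1089–1090] -/
theorem cfold_mul {M : Type*} [CommMonoid M] (f g : ℕ → M) :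
    ∀ cls : List (ℕ × ℕ), cfold (fun a => f a * g a) cls = cfold f cls * cfold g cls
  | [] => by simp
  | (a, p) :: t => by rw [cfold_cons, cfold_cons, cfold_cons, cfold_mul f g t, mul_pow, mul_mul_mul_comm]

/-- The fold of a constant. [cite: FitznerVanDerHofstad2016NoBLE, §5.1.1 (5.4)–(5.5) pp. 1089–1090] -/
theorem cfold_const {M : Type*} [Monoid M] (κ : M) : ∀ cls : List (ℕ × ℕ), cfold (fun _ => κ) cls = κ ^ psumL cls
  | [] => by simp [psumL]
  | (a, p) :: t => by rw [cfold_cons, cfold_const κ t, psumL_cons, pow_add]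

/-- The fold of `2^a`. [cite: FitznerVanDerHofstad2016NoBLE, §5.1.1 (5.4)–(5.5) pp. 1089–1090] -/
theorem cfold_two_pow : ∀ cls : List (ℕ × ℕ), cfold (fun a => (2 : ℂ) ^ a) cls = 2 ^ asumL cls
  | [] => by simp [asumL]
  | (a, p) :: t => by rw [cfold_cons, cfold_two_pow t, asumL_cons, pow_add, ← pow_mul, mul_comm a p]

/-- The fold of `κ/2^a · f`. [cite: FitznerVanDerHofstad2016NoBLE, §5.1.1 (5.4)–(5.5) pp. 1089–1090] -/
theorem cfold_div_two_pow (κ : ℂ) (f : ℕ → ℂ) :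
    ∀ cls : List (ℕ × ℕ), cfold (fun a => κ / 2 ^ a * f a) cls = κ ^ psumL cls / 2 ^ asumL cls * cfold f cls
  | [] => by simp [psumL, asumL]
  | (a, p) :: t => by
      rw [cfold_cons, cfold_cons, cfold_div_two_pow κ f t, psumL_cons, asumL_cons, mul_pow, div_pow,
        ← pow_mul, pow_add, pow_add, mul_comm a p]
      ring

/-- The fold of `κ 2^a · f`. [cite: FitznerVanDerHofstad2016NoBLE, §5.1.1 (5.4)–(5.5) pp. 1089–1090] -/
theorem cfold_mul_two_pow (κ : ℂ) (f : ℕ → ℂ) (cls : List (ℕ × ℕ)) :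
    cfold (fun a => κ * 2 ^ a * f a) cls = κ ^ psumL cls * 2 ^ asumL cls * cfold f cls := by
  rw [cfold_mul, cfold_mul (fun _ => κ) (fun a => (2 : ℂ) ^ a), cfold_const, cfold_two_pow]

/-- The fold of evaluations of polynomials. [cite: FitznerVanDerHofstad2016NoBLE, §5.1.1 (5.4)–(5.5) pp. 1089–1090] -/
theorem eval_cfold (f : ℕ → Polynomial ℂ) (z : ℂ) :
    ∀ cls : List (ℕ × ℕ), (cfold f cls).eval z = cfold (fun a => (f a).eval z) cls
  | [] => by simp
  | (a, p) :: t => by rw [cfold_cons, cfold_cons, Polynomial.eval_mul, Polynomial.eval_pow, eval_cfold f z t]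

/-- Continuity of a fold of continuous functions. [cite: FitznerVanDerHofstad2016NoBLE, §5.1.1 (5.4)–(5.5) pp. 1089–1090] -/
theorem continuous_cfold {f : ℕ → ℝ → ℂ} (hf : ∀ a, Continuous (f a)) :
    ∀ cls : List (ℕ × ℕ), Continuous (fun u => cfold (fun a => f a u) cls)
  | [] => by simp only [cfold_nil]; exact continuous_const
  | (a, p) :: t => by simp only [cfold_cons]; exact ((hf a).pow p).mul (continuous_cfold hf t)

/-- Norm of a fold from a uniform bound on the classes present. [cite: FitznerVanDerHofstad2016NoBLE, §5.1.1 (5.4)–(5.5) pp. 1089–1090] -/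
theorem norm_cfold_le (f : ℕ → ℂ) {B : ℝ} (hB0 : 0 ≤ B) :
    ∀ cls : List (ℕ × ℕ), (∀ ap ∈ cls, ‖f ap.1‖ ≤ B) → ‖cfold f cls‖ ≤ B ^ psumL cls
  | [], _ => by simp [psumL]
  | (a, p) :: t, h => by
      have ha : ‖f a‖ ≤ B := h (a, p) List.mem_cons_self
      have ht := norm_cfold_le f hB0 t fun ap hap => h ap (List.mem_cons_of_mem _ hap)
      rw [cfold_cons, psumL_cons, pow_add, norm_mul, norm_pow]
      exact mul_le_mul (pow_le_pow_left₀ (norm_nonneg _) ha p) ht (norm_nonneg _) (by positivity)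

/-- **Power perturbation**: `‖y^p − x^p‖ ≤ (A+e)^p − A^p` for `‖x‖ ≤ A`, `‖y − x‖ ≤ e`.
[cite: FitznerVanDerHofstad2016NoBLE, §5.1.1 (5.4)–(5.5) pp. 1089–1090] -/
theorem norm_pow_sub_pow_le_of_norm_le {x y : ℂ} {A e : ℝ} (hA : ‖x‖ ≤ A) (he : ‖y - x‖ ≤ e) :
    ∀ p : ℕ, ‖y ^ p - x ^ p‖ ≤ (A + e) ^ p - A ^ p
  | 0 => by simp
  | p + 1 => by
      have ih := norm_pow_sub_pow_le_of_norm_le hA he p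
      have hA0 : 0 ≤ A := (norm_nonneg _).trans hA
      have he0 : 0 ≤ e := (norm_nonneg _).trans he
      have hy : ‖y‖ ≤ A + e := by
        have := norm_add_le (y - x) x; rw [sub_add_cancel] at this; linarith
      have hxp : ‖x ^ p‖ ≤ A ^ p := by rw [norm_pow]; exact pow_le_pow_left₀ (norm_nonneg _) hA p
      have h0 : 0 ≤ (A + e) ^ p - A ^ p := sub_nonneg.mpr (pow_le_pow_left₀ hA0 (by linarith) p)
      have e1 : y ^ (p + 1) - x ^ (p + 1) = (y ^ p - x ^ p) * y + x ^ p * (y - x) := by ring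
      rw [e1]
      calc ‖(y ^ p - x ^ p) * y + x ^ p * (y - x)‖
          ≤ ‖y ^ p - x ^ p‖ * ‖y‖ + ‖x ^ p‖ * ‖y - x‖ := by
            refine (norm_add_le _ _).trans ?_; rw [norm_mul, norm_mul]
        _ ≤ ((A + e) ^ p - A ^ p) * (A + e) + A ^ p * e :=
            add_le_add (mul_le_mul ih hy (norm_nonneg _) h0) (mul_le_mul hxp he (norm_nonneg _) (by positivity))
        _ = (A + e) ^ (p + 1) - A ^ (p + 1) := by ring

/-- **Fold perturbation**: `‖∏ y − ∏ x‖ ≤ (A+e)^{Σp} − A^{Σp}` for `‖x_a‖ ≤ A`, `‖y_a − x_a‖ ≤ e` on the classes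
present. [cite: FitznerVanDerHofstad2016NoBLE, §5.1.1 (5.4)–(5.5) pp. 1089–1090] -/
theorem norm_cfold_sub_cfold_le (x y : ℕ → ℂ) {A e : ℝ} (hA0 : 0 ≤ A) (he0 : 0 ≤ e) :
    ∀ cls : List (ℕ × ℕ), (∀ ap ∈ cls, ‖x ap.1‖ ≤ A) → (∀ ap ∈ cls, ‖y ap.1 - x ap.1‖ ≤ e) →
      ‖cfold y cls - cfold x cls‖ ≤ (A + e) ^ psumL cls - A ^ psumL cls
  | [], _, _ => by simp [psumL]
  | (a, p) :: t, hx, hy => by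
      have hxa : ‖x a‖ ≤ A := hx (a, p) List.mem_cons_self
      have hya : ‖y a - x a‖ ≤ e := hy (a, p) List.mem_cons_self
      have hxt : ∀ ap ∈ t, ‖x ap.1‖ ≤ A := fun ap hap => hx ap (List.mem_cons_of_mem _ hap)
      have hyt : ∀ ap ∈ t, ‖y ap.1 - x ap.1‖ ≤ e := fun ap hap => hy ap (List.mem_cons_of_mem _ hap)
      have ih := norm_cfold_sub_cfold_le x y hA0 he0 t hxt hyt
      have hX := norm_cfold_le x hA0 t hxt
      have hP := norm_pow_sub_pow_le_of_norm_le hxa hya p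
      have hxp : ‖x a ^ p‖ ≤ A ^ p := by rw [norm_pow]; exact pow_le_pow_left₀ (norm_nonneg _) hxa p
      have hY : ‖cfold y t‖ ≤ (A + e) ^ psumL t := by
        have := norm_add_le (cfold y t - cfold x t) (cfold x t); rw [sub_add_cancel] at this; linarith
      have h0 : 0 ≤ (A + e) ^ p - A ^ p := sub_nonneg.mpr (pow_le_pow_left₀ hA0 (by linarith) p)
      have hi0 : 0 ≤ (A + e) ^ psumL t - A ^ psumL t := (norm_nonneg _).trans ih
      have e1 : cfold y ((a, p) :: t) - cfold x ((a, p) :: t)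
          = (y a ^ p - x a ^ p) * cfold y t + x a ^ p * (cfold y t - cfold x t) := by
        rw [cfold_cons, cfold_cons]; ring
      rw [e1, psumL_cons, pow_add, pow_add]
      calc ‖(y a ^ p - x a ^ p) * cfold y t + x a ^ p * (cfold y t - cfold x t)‖
          ≤ ‖y a ^ p - x a ^ p‖ * ‖cfold y t‖ + ‖x a ^ p‖ * ‖cfold y t - cfold x t‖ := by
            refine (norm_add_le _ _).trans ?_; rw [norm_mul, norm_mul]
        _ ≤ ((A + e) ^ p - A ^ p) * (A + e) ^ psumL t + A ^ p * ((A + e) ^ psumL t - A ^ psumL t) :=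
            add_le_add (mul_le_mul hP hY (norm_nonneg _) h0) (mul_le_mul hxp ih (norm_nonneg _) (by positivity))
        _ = (A + e) ^ p * (A + e) ^ psumL t - A ^ p * A ^ psumL t := by ring

/-- `∏_{μ : Fin D} f(a μ)` is the class-list fold when `a` unrolls the class list.
[cite: FitznerVanDerHofstad2016NoBLE, §5.1.1 (5.4)–(5.5) pp. 1089–1090] -/
theorem prod_map_unroll {M : Type*} [CommMonoid M] (f : ℕ → M) :
    ∀ cls : List (ℕ × ℕ), ((unroll cls).map f).prod = cfold f cls
  | [] => by simp [unroll]
  | (a, p) :: t => by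
      rw [unroll, List.map_append, List.prod_append, List.map_replicate, List.prod_replicate, cfold_cons,
        prod_map_unroll f t]

/-- `∏_{μ : Fin D} f(a μ) = cfold f cls` for `List.ofFn a = unroll cls`.
[cite: FitznerVanDerHofstad2016NoBLE, §5.1.1 (5.4)–(5.5) pp. 1089–1090] -/
theorem prod_fin_eq_cfold {M : Type*} [CommMonoid M] (f : ℕ → M) (cls : List (ℕ × ℕ)) {D : ℕ}
    (a : Fin D → ℕ) (ha : List.ofFn a = unroll cls) : ∏ μ, f (a μ) = cfold f cls := by
  rw [← prod_map_unroll f cls, ← ha, List.map_ofFn, List.prod_ofFn]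
  rfl

/-- The number of coordinates is `Σ_r p_r`. [cite: FitznerVanDerHofstad2016NoBLE, §5.1.1 (5.4)–(5.5) pp. 1089–1090] -/
theorem length_unroll : ∀ cls : List (ℕ × ℕ), (unroll cls).length = psumL cls
  | [] => by simp [unroll, psumL]
  | (a, p) :: t => by rw [unroll, List.length_append, List.length_replicate, length_unroll t, psumL_cons]

/-- A member of a list is at most `maxN`. [cite: FitznerVanDerHofstad2016NoBLE, §5.1.1 (5.4)–(5.5) pp. 1089–1090] -/
theorem le_maxN_of_mem {l : List ℕ} {x : ℕ} (h : x ∈ l) : x ≤ maxN l := by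
  obtain ⟨i, hi, rfl⟩ := List.getElem_of_mem h
  have := getD_le_maxN l i
  rwa [List.getD_eq_getElem?_getD, List.getElem?_eq_getElem hi, Option.getD_some] at this

/-- `Σ_{s ≤ a} C(a,s)/2^a = 1`. [cite: FitznerVanDerHofstad2016NoBLE, §5.1.1 (5.4)–(5.5) pp. 1089–1090] -/
theorem sum_choose_div_two_pow (a : ℕ) : ∑ s ∈ range (a + 1), ((a.choose s : ℕ) : ℝ) / 2 ^ a = 1 := by
  rw [← sum_div, div_eq_one_iff_eq (by positivity)]
  exact_mod_cast Nat.sum_range_choose a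

end Folds

/-! ### Part 6a: the analytic class rows, the Poisson-block terms, the two-sided `[0,T]` block -/

section Block0

/-- **The analytic class row** `Ψ_a(u) = Σ_{j ≤ J} Σ_{s ≤ a} ε_j i^j (Q_j/qden) (C(a,s)/2^a) q_u(|jm+a-2s|)`.
[cite: FitznerVanDerHofstad2016NoBLE, §5.1.1 (5.4)–(5.5) pp. 1089–1090] -/
noncomputable def prPsi (m J : ℕ) (Q : ℕ → ℤ) (qden a : ℕ) (u : ℝ) : ℂ :=
  ∑ j ∈ range (J + 1), ∑ s ∈ range (a + 1), (epsN j : ℂ) * Complex.I ^ j * ((Q j : ℂ) / (qden : ℂ))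
    * ((((a.choose s : ℕ) : ℝ) / 2 ^ a : ℝ) : ℂ) * (srwHeatKernel u ((cosOrd m a j s : ℕ) : ℤ) : ℂ)

/-- **The analytic product row** `Ψ_cls(u) = ∏_r Ψ_{a_r}(u)^{p_r}`. [cite: FitznerVanDerHofstad2016NoBLE, §5.1.1 (5.4)–(5.5) pp. 1089–1090] -/
noncomputable def prPsiP (m J : ℕ) (Q : ℕ → ℤ) (qden : ℕ) (cls : List (ℕ × ℕ)) (u : ℝ) : ℂ :=
  cfold (fun a => prPsi m J Q qden a u) cls

/-- **The Poisson-block coefficient** `t_N = N! · Re [s^N]F / (qden^D 2^A)`, `A = Σ_r p_r a_r`.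
[cite: FitznerVanDerHofstad2016NoBLE, §5.1.1 (5.4)–(5.5) pp. 1089–1090] -/
noncomputable def prT (m J : ℕ) (Q : ℕ → ℤ) (qden D : ℕ) (cls : List (ℕ × ℕ)) (N : ℕ) : ℝ :=
  (N ! : ℝ) * (PowerSeries.coeff N (prF m J Q cls)).re / ((qden : ℝ) ^ D * 2 ^ asumL cls)

/-- `Ψ_a(u) = e^{-u}/(qden 2^a) · Φ_a(u/2)`. [cite: FitznerVanDerHofstad2016NoBLE, §5.1.1 (5.4)–(5.5) pp. 1089–1090] -/
theorem prPsi_eq (m J : ℕ) (Q : ℕ → ℤ) (qden a : ℕ) (u : ℝ) :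
    prPsi m J Q qden a u = ((Real.exp (-u) : ℝ) : ℂ) / (qden : ℂ) / 2 ^ a * twRowFun2 m J Q a (u / 2) := by
  rw [prPsi, twRowFun2, Finset.mul_sum]
  refine sum_congr rfl fun j _ => ?_
  rw [Finset.mul_sum]
  refine sum_congr rfl fun s _ => ?_
  rw [srwHeatKernel_eq_exp_neg_mul_besselI, show 2 * (u / 2) = u by ring]
  push_cast
  ring

/-- `Ψ_cls(u) = e^{-(Σp)u}/(qden^{Σp} 2^A) · ∏_r Φ_{a_r}(u/2)^{p_r}`. [cite: FitznerVanDerHofstad2016NoBLE, §5.1.1 (5.4)–(5.5) pp. 1089–1090] -/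
theorem prPsiP_eq (m J : ℕ) (Q : ℕ → ℤ) (qden : ℕ) (cls : List (ℕ × ℕ)) (u : ℝ) :
    prPsiP m J Q qden cls u
      = (((Real.exp (-((psumL cls : ℝ) * u)) / ((qden : ℝ) ^ psumL cls * 2 ^ asumL cls) : ℝ)) : ℂ)
        * prFFun m J Q (u / 2) cls := by
  have h : Real.exp (-((psumL cls : ℝ) * u)) = Real.exp (-u) ^ psumL cls := by
    rw [← Real.exp_nat_mul]; congr 1; ring
  have hf : (fun a => prPsi m J Q qden a u)
      = fun a => (((Real.exp (-u) : ℝ) : ℂ) / (qden : ℂ)) / 2 ^ a * twRowFun2 m J Q a (u / 2) :=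
    funext fun a => prPsi_eq m J Q qden a u
  rw [prPsiP, hf, cfold_div_two_pow, ← prFFun_eq_cfold, h, div_pow]
  push_cast
  ring

/-- `Re Ψ_cls(u) = e^{-(Σp)u}/(qden^{Σp} 2^A) · Re ∏_r Φ_{a_r}(u/2)^{p_r}`. [cite: FitznerVanDerHofstad2016NoBLE, §5.1.1 (5.4)–(5.5) pp. 1089–1090] -/
theorem re_prPsiP (m J : ℕ) (Q : ℕ → ℤ) (qden : ℕ) (cls : List (ℕ × ℕ)) (u : ℝ) :
    (prPsiP m J Q qden cls u).re
      = Real.exp (-((psumL cls : ℝ) * u)) / ((qden : ℝ) ^ psumL cls * 2 ^ asumL cls)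
        * (prFFun m J Q (u / 2) cls).re := by
  rw [prPsiP_eq, Complex.re_ofReal_mul]

/-- **Pointwise**: `Σ_N g_N^{Re[s^N]F/(qden^D 2^A)}(u) = D^{n'+1}/n'! · u^{n'} Re Ψ_cls(u)` (`Σp = D`).
[cite: FitznerVanDerHofstad2016NoBLE, §5.1.1 (5.4)–(5.5) pp. 1089–1090] -/
theorem hasSum_gTermP (m J : ℕ) (Q : ℕ → ℤ) (qden : ℕ) (hm : 0 < m)
    (hQ : ∀ j, j ≤ J → (Q j).natAbs ≤ qden) (cls : List (ℕ × ℕ)) (hps : ∀ ap ∈ cls, 1 ≤ ap.2)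
    {D : ℕ} (hD : psumL cls = D) (n' : ℕ) (u : ℝ) :
    HasSum (fun N => gTerm D n' ((PowerSeries.coeff N (prF m J Q cls)).re / ((qden : ℝ) ^ D * 2 ^ asumL cls)) N u)
      ((D : ℝ) ^ (n' + 1) / (n' ! : ℝ) * (u ^ n' * (prPsiP m J Q qden cls u).re)) := by
  have h := hasSum_coeff_prF m J Q qden hm hQ (u / 2) cls hps
  have h2 := Complex.reCLM.hasSum h
  simp only [Complex.reCLM_apply] at h2
  have h3 : HasSum (fun N => (PowerSeries.coeff N (prF m J Q cls)).re * (u / 2) ^ N)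
      (prFFun m J Q (u / 2) cls).re := by
    refine h2.congr_fun fun N => ?_
    show _ = (PowerSeries.coeff N (prF m J Q cls) * ((u / 2 : ℝ) : ℂ) ^ N).re
    rw [← Complex.ofReal_pow, Complex.re_mul_ofReal]
  have h4 := h3.mul_left ((D : ℝ) ^ (n' + 1) / (n' ! : ℝ)
    * (u ^ n' * (Real.exp (-((D : ℝ) * u)) / ((qden : ℝ) ^ D * 2 ^ asumL cls))))
  have h5 : HasSum (fun N => gTerm D n' ((PowerSeries.coeff N (prF m J Q cls)).re
        / ((qden : ℝ) ^ D * 2 ^ asumL cls)) N u)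
      ((D : ℝ) ^ (n' + 1) / (n' ! : ℝ) * (u ^ n' * (Real.exp (-((D : ℝ) * u)) / ((qden : ℝ) ^ D * 2 ^ asumL cls)))
        * (prFFun m J Q (u / 2) cls).re) :=
    h4.congr_fun fun N => by rw [gTerm]; ring
  rw [re_prPsiP, hD, show (D : ℝ) ^ (n' + 1) / (n' ! : ℝ) * (u ^ n' * (Real.exp (-((D : ℝ) * u))
      / ((qden : ℝ) ^ D * 2 ^ asumL cls) * (prFFun m J Q (u / 2) cls).re)) = (D : ℝ) ^ (n' + 1) / (n' ! : ℝ)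
      * (u ^ n' * (Real.exp (-((D : ℝ) * u)) / ((qden : ℝ) ^ D * 2 ^ asumL cls))) * (prFFun m J Q (u / 2) cls).re by ring]
  exact h5

/-- `|t_N| ≤ (2D)^N` (the walk-count majorant for the product, `|Q_j| ≤ qden`, `Σp = D`).
[cite: FitznerVanDerHofstad2016NoBLE, §5.1.1 (5.4)–(5.5) pp. 1089–1090] -/
theorem abs_prT_le (m J : ℕ) (Q : ℕ → ℤ) (qden : ℕ) (hm : 0 < m) (hq : 0 < qden)
    (hQ : ∀ j, j ≤ J → (Q j).natAbs ≤ qden) (cls : List (ℕ × ℕ)) (hps : ∀ ap ∈ cls, 1 ≤ ap.2)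
    {D : ℕ} (hD : psumL cls = D) (N : ℕ) :
    |prT m J Q qden D cls N| ≤ (2 * D : ℝ) ^ N := by
  have hb := norm_coeff_prF_le m J Q qden hm hQ cls hps N
  rw [hD] at hb
  have hre := Complex.abs_re_le_norm (PowerSeries.coeff N (prF m J Q cls))
  have hqD : (0 : ℝ) < (qden : ℝ) ^ D * 2 ^ asumL cls := by positivity
  have hN : (0 : ℝ) ≤ (N ! : ℝ) := by positivity
  rw [prT, abs_div, abs_of_pos hqD, div_le_iff₀ hqD, abs_mul, abs_of_nonneg hN]
  calc (N ! : ℝ) * |(PowerSeries.coeff N (prF m J Q cls)).re|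
      ≤ (N ! : ℝ) * ‖PowerSeries.coeff N (prF m J Q cls)‖ := mul_le_mul_of_nonneg_left hre hN
    _ ≤ ((qden : ℝ) ^ D * 2 ^ asumL cls) * (2 * D : ℝ) ^ N := hb
    _ = (2 * D : ℝ) ^ N * ((qden : ℝ) ^ D * 2 ^ asumL cls) := mul_comm _ _

/-- The norm of the `N`-th Poisson-block term is dominated by the plain Poissonised term (`u ≥ 0`).
[cite: FitznerVanDerHofstad2016NoBLE, §5.1.1 (5.4)–(5.5) pp. 1089–1090] -/
theorem norm_gTermP_le (m J : ℕ) (Q : ℕ → ℤ) (qden : ℕ) (hm : 0 < m) (hq : 0 < qden)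
    (hQ : ∀ j, j ≤ J → (Q j).natAbs ≤ qden) (cls : List (ℕ × ℕ)) (hps : ∀ ap ∈ cls, 1 ≤ ap.2)
    {D : ℕ} (hD : psumL cls = D) (n' N : ℕ) {u : ℝ} (hu : 0 ≤ u) :
    ‖gTerm D n' ((PowerSeries.coeff N (prF m J Q cls)).re / ((qden : ℝ) ^ D * 2 ^ asumL cls)) N u‖
      ≤ gTerm D n' ((2 * D : ℝ) ^ N / (N ! : ℝ)) N u := by
  have hb := norm_coeff_prF_le m J Q qden hm hQ cls hps N
  rw [hD] at hb
  have hre := Complex.abs_re_le_norm (PowerSeries.coeff N (prF m J Q cls))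
  have hqD : (0 : ℝ) < (qden : ℝ) ^ D * 2 ^ asumL cls := by positivity
  have hN : (0 : ℝ) < (N ! : ℝ) := by positivity
  have key : |(PowerSeries.coeff N (prF m J Q cls)).re / ((qden : ℝ) ^ D * 2 ^ asumL cls)|
      ≤ (2 * D : ℝ) ^ N / (N ! : ℝ) := by
    rw [abs_div, abs_of_pos hqD, div_le_iff₀ hqD, div_mul_eq_mul_div, le_div_iff₀ hN]
    calc |(PowerSeries.coeff N (prF m J Q cls)).re| * (N ! : ℝ)
        ≤ ‖PowerSeries.coeff N (prF m J Q cls)‖ * (N ! : ℝ) := mul_le_mul_of_nonneg_right hre hN.le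
      _ ≤ (2 * D : ℝ) ^ N * ((qden : ℝ) ^ D * 2 ^ asumL cls) := by rw [mul_comm]; linarith [hb]
  have hW := gTerm_one_nonneg D n' N hu
  rw [gTerm_eq_mul, gTerm_eq_mul D n' ((2 * D : ℝ) ^ N / (N ! : ℝ)), norm_mul, Real.norm_of_nonneg hW,
    Real.norm_eq_abs]
  exact mul_le_mul_of_nonneg_right key hW

/-- **The `[0,T]` block is the signed Poisson-tail series** for the product row (`Σp = D ≥ 1`).
[cite: FitznerVanDerHofstad2016NoBLE, §5.1.1 (5.4)–(5.5) pp. 1089–1090] -/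
theorem hasSum_block0P (m J : ℕ) (Q : ℕ → ℤ) (qden : ℕ) (hm : 0 < m) (hq : 0 < qden)
    (hQ : ∀ j, j ≤ J → (Q j).natAbs ≤ qden) (cls : List (ℕ × ℕ)) (hps : ∀ ap ∈ cls, 1 ≤ ap.2)
    {D : ℕ} (hpD : psumL cls = D) (hD : 1 ≤ D) (n' : ℕ) {T : ℝ} (hT : 0 ≤ T)
    {Mx : ℕ} (hMx : (D : ℝ) * T < Mx + 1) :
    HasSum (fun N => (((N + n').choose n' : ℕ) : ℝ) * (prT m J Q qden D cls N / (2 * D : ℝ) ^ N)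
        * poissonTail ((D : ℝ) * T) (N + n' + 1))
      ((D : ℝ) ^ (n' + 1) / (n' ! : ℝ) * ∫ u in Ioc 0 T, u ^ n' * (prPsiP m J Q qden cls u).re) := by
  set F : ℕ → ℝ → ℝ :=
    fun N u => gTerm D n' ((PowerSeries.coeff N (prF m J Q cls)).re / ((qden : ℝ) ^ D * 2 ^ asumL cls)) N u with hF
  have hint : ∀ N, Integrable (F N) (volume.restrict (Ioc 0 T)) :=
    fun N => (continuous_gTerm D n' _ N).integrableOn_Ioc
  have hD1 : (1 : ℝ) ≤ D := by exact_mod_cast hD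
  have h2D0 : (0 : ℝ) < 2 * D := by linarith
  have hle : ∀ N, ∫ u in Ioc 0 T, ‖F N u‖
      ≤ (((N + n').choose n' : ℕ) : ℝ) * poissonTail ((D : ℝ) * T) (N + n' + 1) := by
    intro N
    have hNf : (N ! : ℝ) ≠ 0 := by positivity
    have h2DN : (2 * D : ℝ) ^ N ≠ 0 := pow_ne_zero N h2D0.ne'
    calc ∫ u in Ioc 0 T, ‖F N u‖ ≤ ∫ u in Ioc 0 T, gTerm D n' ((2 * D : ℝ) ^ N / (N ! : ℝ)) N u := by
          refine setIntegral_mono_on (hint N).norm (continuous_gTerm D n' _ N).integrableOn_Ioc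
            measurableSet_Ioc fun u hu => ?_
          exact norm_gTermP_le m J Q qden hm hq hQ cls hps hpD n' N (le_of_lt hu.1)
      _ = (((N + n').choose n' : ℕ) : ℝ) * poissonTail ((D : ℝ) * T) (N + n' + 1) := by
          rw [integral_gTerm_Ioc hD n' _ N hT, div_mul_cancel₀ _ hNf, div_self h2DN, mul_one]
  have hnn : ∀ N, 0 ≤ ∫ u in Ioc 0 T, ‖F N u‖ := fun N => integral_nonneg fun u => norm_nonneg _
  have hlam0 : (0 : ℝ) ≤ (D : ℝ) * T := by positivity
  obtain ⟨hS, -⟩ := tsum_choose_mul_poissonTail_le hlam0 Mx n' hMx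
  have hS' : Summable (fun N => (((N + n').choose n' : ℕ) : ℝ) * poissonTail ((D : ℝ) * T) (N + n' + 1)) :=
    (summable_nat_add_iff (f := fun N => (((N + n').choose n' : ℕ) : ℝ)
      * poissonTail ((D : ℝ) * T) (N + n' + 1)) Mx).mp hS
  have hsum : Summable fun N => ∫ u in Ioc 0 T, ‖F N u‖ := Summable.of_nonneg_of_le hnn hle hS'
  have hswap := hasSum_integral_of_summable_integral_norm (μ := volume.restrict (Ioc 0 T)) hint hsum
  have hpt : (fun u => ∑' N, F N u)
      = fun u => (D : ℝ) ^ (n' + 1) / (n' ! : ℝ) * (u ^ n' * (prPsiP m J Q qden cls u).re) :=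
    funext fun u => (hasSum_gTermP m J Q qden hm hQ cls hps hpD n' u).tsum_eq
  rw [hpt, integral_const_mul] at hswap
  refine hswap.congr_fun fun N => ?_
  simp only [hF]
  rw [integral_gTerm_Ioc hD n' _ N hT, prT]
  ring

/-- `t_N = 0` for odd `N` when the real parts of `F` live on even exponents.
[cite: FitznerVanDerHofstad2016NoBLE, §5.1.1 (5.4)–(5.5) pp. 1089–1090] -/
theorem prT_odd (m J : ℕ) (Q : ℕ → ℤ) (qden D : ℕ) (cls : List (ℕ × ℕ))
    (hre0 : ∀ N, N % 2 ≠ 0 → (PowerSeries.coeff N (prF m J Q cls)).re = 0) (N : ℕ) (hN : N % 2 = 1) :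
    prT m J Q qden D cls N = 0 := by
  rw [prT, hre0 N (by omega), mul_zero, zero_div]

namespace PrCert

variable (c : PrCert) (D : ℕ)

/-- `psum = psumL cls`, `asum = asumL cls`. [cite: FitznerVanDerHofstad2016NoBLE, §5.1.1 (5.4)–(5.5) pp. 1089–1090] -/
theorem psum_eq_psumL : c.psum = psumL c.cls := rfl

/-- `asum = asumL cls`. [cite: FitznerVanDerHofstad2016NoBLE, §5.1.1 (5.4)–(5.5) pp. 1089–1090] -/
theorem asum_eq_asumL : c.asum = asumL c.cls := rfl

/-- **The two-sided `[0,T]` block** for the product row: with `B₀ = D^{n'+1}/n'! ∫_{(0,T]} u^{n'} Re Ψ_cls(u) du`,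
`|B₀ - (P_n - e^{-λ} U_n)| ≤ R⁺_n` (`n = n'+1`; `P_n`, `U_n` the exact Horner sums of the kernel-evaluated
product table with real parity `0`). [cite: FitznerVanDerHofstad2016NoBLE, §5.1.1 (5.4)–(5.5) pp. 1089–1090] -/
theorem ioc_blockP (hD : 1 ≤ D) (hm : 0 < c.m) (hq : 0 < c.qden)
    (hQ : ∀ j, j ≤ c.J → (c.Q j).natAbs ≤ c.qden) (hne : c.cls ≠ []) (hps : ∀ ap ∈ c.cls, 1 ≤ ap.2)
    (hpsum : c.psum = D) (hflag : c.tableP.2.1 = 0) (n' : ℕ)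
    (hK : c.cnt (n' + 1) ≤ c.K + 1) (hMlam : c.lamT D + 1 < c.M (n' + 1)) (helo : 0 ≤ expNegOneLo) :
    |(D : ℝ) ^ (n' + 1) / (n' ! : ℝ)
          * (∫ u in Ioc 0 ((c.t : ℝ) ^ 2), u ^ n' * (prPsiP c.m c.J c.Q c.qden c.cls u).re)
        - (((c.PqP D c.tableP.1.1 (n' + 1) : ℚ) : ℝ)
            - Real.exp (-(c.lamT D : ℝ)) * ((c.UqP D c.tableP.1.1 (n' + 1) : ℚ) : ℝ))|
      ≤ ((c.RplusT D (n' + 1) : ℚ) : ℝ) := by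
  set M := c.M (n' + 1) with hMdef
  have hT : (0 : ℝ) ≤ (c.t : ℝ) ^ 2 := by positivity
  have hlam := c.cast_lamT D
  have hlam0 : (0 : ℝ) ≤ (c.lamT D : ℝ) := Nat.cast_nonneg _
  have hMx : (D : ℝ) * (c.t : ℝ) ^ 2 < (M : ℝ) + 1 := by
    rw [hlam]; exact_mod_cast (by omega : c.lamT D < M + 1)
  have hMlt : (c.lamT D : ℝ) < (M : ℝ) + 1 := by rw [← hlam]; exact hMx
  have hD1 : (1 : ℝ) ≤ D := by exact_mod_cast hD
  have h2D0 : (0 : ℝ) < 2 * D := by linarith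
  have hpD : psumL c.cls = D := by rw [← c.psum_eq_psumL]; exact hpsum
  obtain ⟨hinv, hpar⟩ := c.tableP_spec hne hps
  have hre : ∀ i, i ≤ c.K → (zval c.tableP.1.1 i : ℝ)
      = (c.Mh ! : ℝ) * (PowerSeries.coeff (2 * i) (prF c.m c.J c.Q c.cls)).re := by
    intro i hi
    have := hinv.re i hi
    rwa [hflag, add_zero] at this
  have hl1 : c.tableP.1.1.1.length = c.K + 1 := hinv.len.1
  have hl2 : c.tableP.1.1.2.length = c.K + 1 := hinv.len.2.1
  have hre0 : ∀ N, N % 2 ≠ 0 → (PowerSeries.coeff N (prF c.m c.J c.Q c.cls)).re = 0 := by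
    intro N hN; exact hpar.1 N (by rw [hflag]; exact hN)
  -- the block as the signed Poisson-tail series
  set f : ℕ → ℝ := fun N => (((N + n').choose n' : ℕ) : ℝ)
    * (prT c.m c.J c.Q c.qden D c.cls N / (2 * D : ℝ) ^ N)
    * poissonTail (c.lamT D : ℝ) (N + n' + 1) with hf
  have hHS : HasSum f ((D : ℝ) ^ (n' + 1) / (n' ! : ℝ)
      * ∫ u in Ioc 0 ((c.t : ℝ) ^ 2), u ^ n' * (prPsiP c.m c.J c.Q c.qden c.cls u).re) := by
    have h := hasSum_block0P c.m c.J c.Q c.qden hm hq hQ c.cls hps hpD hD n' hT hMx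
    rw [hlam] at h
    exact h
  rw [← hHS.tsum_eq, ← hHS.summable.sum_add_tsum_nat_add M]
  -- the head `Σ_{N<M} f N = P_n - e^{-λ} U_n`
  have hodd : ∀ N, N % 2 = 1 → f N = 0 := fun N hN => by
    simp only [hf, prT_odd c.m c.J c.Q c.qden D c.cls hre0 N hN, zero_div, mul_zero, zero_mul]
  have hhead : ∑ N ∈ range M, f N = ((c.PqP D c.tableP.1.1 (n' + 1) : ℚ) : ℝ)
      - Real.exp (-(c.lamT D : ℝ)) * ((c.UqP D c.tableP.1.1 (n' + 1) : ℚ) : ℝ) := by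
    rw [sum_range_even f hodd M, show (M + 1) / 2 = c.cnt (n' + 1) from rfl,
      c.PqP_real D hre hl1 hl2 (n' + 1) hK hD hq, c.UqP_real D hre hl1 hl2 (n' + 1) hK hD hq,
      Finset.mul_sum, ← Finset.sum_sub_distrib]
    refine sum_congr rfl fun i _ => ?_
    simp only [hf, Nat.add_sub_cancel, prT, poissonTail, Cert.cast_EQ, c.asum_eq_asumL]
    push_cast
    ring
  rw [hhead, add_sub_cancel_left]
  -- the tail
  obtain ⟨hS, hbd⟩ := tsum_choose_mul_poissonTail_le hlam0 M n' hMlt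
  have hterm : ∀ k, ‖f (k + M)‖ ≤ (((k + M + n').choose n' : ℕ) : ℝ)
      * poissonTail (c.lamT D : ℝ) (k + M + n' + 1) := by
    intro k
    have hPT := poissonTail_nonneg hlam0 (k + M + n' + 1)
    have ht := abs_prT_le c.m c.J c.Q c.qden hm hq hQ c.cls hps hpD (k + M)
    have hpow : (0 : ℝ) < (2 * D : ℝ) ^ (k + M) := pow_pos h2D0 _
    have h1 : |prT c.m c.J c.Q c.qden D c.cls (k + M) / (2 * D : ℝ) ^ (k + M)| ≤ 1 := by
      rw [abs_div, abs_of_pos hpow, div_le_one hpow]; exact ht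
    simp only [hf, Real.norm_eq_abs, abs_mul, Nat.abs_cast, abs_of_nonneg hPT]
    calc (((k + M + n').choose n' : ℕ) : ℝ) * |prT c.m c.J c.Q c.qden D c.cls (k + M) / (2 * D : ℝ) ^ (k + M)|
          * poissonTail (c.lamT D : ℝ) (k + M + n' + 1)
        ≤ (((k + M + n').choose n' : ℕ) : ℝ) * 1 * poissonTail (c.lamT D : ℝ) (k + M + n' + 1) := by
          gcongr
      _ = _ := by rw [mul_one]
  have htail := tsum_of_norm_bounded hS.hasSum hterm
  rw [Real.norm_eq_abs] at htail
  refine htail.trans (hbd.trans ?_)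
  rw [c.RplusT_real D n']
  obtain ⟨_, hrhi⟩ := exp_neg_nat_mem (c.lamT D) helo
  have hrhi' : Real.exp (-(c.lamT D : ℝ)) ≤ ((c.rHiT D : ℚ) : ℝ) := by
    simpa [TwCert.rHiT] using hrhi
  apply mul_le_mul_of_nonneg_right hrhi'
  have h1 : (0 : ℝ) < (M : ℝ) + n' + 2 - (c.lamT D : ℝ) := by
    linarith [(Nat.cast_nonneg n' : (0 : ℝ) ≤ n')]
  have h2 : (0 : ℝ) < (M : ℝ) + 1 - (c.lamT D : ℝ) := by linarith
  positivity

end PrCert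

end Block0


/-! ### Part 6b: unpacking the Boolean checks of a product certificate -/

section Specs

namespace PrCert

variable (c : PrCert) (D : ℕ)

/-- The real-side facts encoded by `paramsOKP` (the single-row facts `ParamsT` of the underlying `TwCert`
plus the product facts). [cite: FitznerVanDerHofstad2016NoBLE, §5.1.1 (5.4)–(5.5) pp. 1089–1090] -/
structure ParamsP : Prop where
  toT : c.toTwCert.ParamsT D
  ne : c.cls ≠ []
  p_pos : ∀ ap ∈ c.cls, 1 ≤ ap.2
  psum_eq : c.psum = D
  asum_even : c.asum % 2 = 0
  epsb_nonneg : ∀ b, b ≤ c.maxOrd → 0 ≤ c.eps b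
  epsb_ge : ∀ b, b ≤ c.maxOrd → epsBoundQ b c.Jb c.s0 c.t c.sHi c.nexp ≤ c.eps b
  midb_dy : ∀ b, b ≤ c.maxOrd → ∀ q ∈ midList b c.Jb, dyadicOK c.S q = true
  weps2_le : ∀ ap ∈ c.cls, c.wepsSum2 ap.1 ≤ c.rho * c.qden * (2 : ℚ) ^ ap.1

/-- Unpacking of the Boolean parameter check. [cite: FitznerVanDerHofstad2016NoBLE, §5.1.1 (5.4)–(5.5) pp. 1089–1090] -/
theorem paramsP_of_paramsOKP (h : c.paramsOKP D = true) : c.ParamsP D := by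
  simp only [paramsOKP, extraOKP, Bool.and_eq_true, decide_eq_true_eq, List.all_eq_true, List.mem_range] at h
  obtain ⟨h1, ⟨⟨⟨⟨a1, a2⟩, a3⟩, a4⟩, a5⟩, a6⟩ := h
  exact ⟨c.toTwCert.paramsT_of_paramsOKT D h1, a1, fun ap hap => a2 ap hap, a3, a4,
    fun b hb => (a5 b (by omega)).1.1, fun b hb => (a5 b (by omega)).1.2, fun b hb => (a5 b (by omega)).2,
    fun ap hap => a6 ap hap⟩

/-- Unpacking of `poissonCheckP`. [cite: FitznerVanDerHofstad2016NoBLE, §5.1.1 (5.4)–(5.5) pp. 1089–1090] -/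
theorem poissonCheckP_spec (h : c.poissonCheckP D = true) :
    c.tableP.2.1 = 0 ∧ ∀ n, 1 ≤ n → n ≤ 4 →
      c.pLo n ≤ c.PqP D c.tableP.1.1 n ∧ c.PqP D c.tableP.1.1 n ≤ c.pHi n ∧
      c.uLo n ≤ c.UqP D c.tableP.1.1 n ∧ c.UqP D c.tableP.1.1 n ≤ c.uHi n := by
  simp only [poissonCheckP, List.all_eq_true, List.mem_range, Bool.and_eq_true, decide_eq_true_eq] at h
  obtain ⟨h0, h⟩ := h
  refine ⟨h0, fun n hn1 hn4 => ?_⟩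
  obtain ⟨⟨⟨a1, a2⟩, a3⟩, a4⟩ := h (n - 1) (by omega)
  rw [show n - 1 + 1 = n by omega] at a1 a2 a3 a4
  exact ⟨a1, a2, a3, a4⟩

/-- Unpacking of `tailCheckIM`. [cite: FitznerVanDerHofstad2016NoBLE, §5.1.1 (5.4)–(5.5) pp. 1089–1090] -/
theorem tailCheckIM_spec (h : c.tailCheckIM D = true) (n : ℕ) (hn1 : 1 ≤ n) (hn4 : n ≤ 4) :
    c.imLo n ≤ c.IM2 D c.powRe2 n ∧ c.IM2 D c.powRe2 n ≤ c.imHi n := by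
  simp only [tailCheckIM, List.all_eq_true, List.mem_range, Bool.and_eq_true, decide_eq_true_eq] at h
  obtain ⟨a1, a2⟩ := h (n - 1) (by omega)
  rw [show n - 1 + 1 = n by omega] at a1 a2
  exact ⟨a1, a2⟩

/-- Unpacking of `tailCheckIB`. [cite: FitznerVanDerHofstad2016NoBLE, §5.1.1 (5.4)–(5.5) pp. 1089–1090] -/
theorem tailCheckIB_spec (h : c.tailCheckIB D = true) (n : ℕ) (hn1 : 1 ≤ n) (hn4 : n ≤ 4) :
    c.toTwCert.IB D (powN c.lg c.g2 D, powN c.lg c.g1 D) n ≤ c.ibHi n := by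
  simp only [tailCheckIB, List.all_eq_true, List.mem_range, decide_eq_true_eq] at h
  have a1 := h (n - 1) (by omega)
  rwa [show n - 1 + 1 = n by omega] at a1

/-- Unpacking of `checkP`. [cite: FitznerVanDerHofstad2016NoBLE, §5.1.1 (5.4)–(5.5) pp. 1089–1090] -/
theorem checkP_spec (h : c.checkP D = true) :
    c.paramsOKP D = true ∧ c.toTwCert.finalCheckT D = true ∧ c.poissonCheckP D = true ∧
      c.tailCheckIM D = true ∧ c.tailCheckIB D = true := by
  simp only [checkP, tailCheckP, Bool.and_eq_true] at h
  obtain ⟨⟨⟨a1, a2⟩, a3⟩, a4, a5⟩ := h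
  exact ⟨a1, a2, a3, a4, a5⟩

/-- **The `[0,T]` block from the checks**: `pLo n - eUB n - R⁺_n ≤ B₀ ≤ pHi n - eLB n + R⁺_n` (`n = n'+1 ≤ 4`).
[cite: FitznerVanDerHofstad2016NoBLE, §5.1.1 (5.4)–(5.5) pp. 1089–1090] -/
theorem ioc_blockP_bracket (hp : c.ParamsP D) (hpc : c.poissonCheckP D = true) (n' : ℕ) (hn : n' ≤ 3) :
    ((c.pLo (n' + 1) : ℚ) : ℝ) - ((c.eUB D (n' + 1) : ℚ) : ℝ) - ((c.RplusT D (n' + 1) : ℚ) : ℝ)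
      ≤ (D : ℝ) ^ (n' + 1) / (n' ! : ℝ)
          * (∫ u in Ioc 0 ((c.t : ℝ) ^ 2), u ^ n' * (prPsiP c.m c.J c.Q c.qden c.cls u).re) ∧
    (D : ℝ) ^ (n' + 1) / (n' ! : ℝ)
          * (∫ u in Ioc 0 ((c.t : ℝ) ^ 2), u ^ n' * (prPsiP c.m c.J c.Q c.qden c.cls u).re)
      ≤ ((c.pHi (n' + 1) : ℚ) : ℝ) - ((c.eLB D (n' + 1) : ℚ) : ℝ) + ((c.RplusT D (n' + 1) : ℚ) : ℝ) := by
  have hn1 : 1 ≤ n' + 1 := by omega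
  have hn4 : n' + 1 ≤ 4 := by omega
  have hD : 1 ≤ D := le_trans (by norm_num) hp.toT.hD
  obtain ⟨hflag, hP⟩ := c.poissonCheckP_spec D hpc
  have hblk := c.ioc_blockP D hD hp.toT.m_pos hp.toT.qden_pos hp.toT.Q_le hp.ne hp.p_pos hp.psum_eq hflag n'
    (hp.toT.cnt_le _ hn1 hn4) (hp.toT.lam_lt _ hn1 hn4) hp.toT.eLo_nonneg
  obtain ⟨hpl, hph, hul, huh⟩ := hP (n' + 1) hn1 hn4
  obtain ⟨hrlo, hrhi⟩ := exp_neg_nat_mem (c.lamT D) hp.toT.eLo_nonneg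
  have hrlo' : ((c.rLoT D : ℚ) : ℝ) ≤ Real.exp (-(c.lamT D : ℝ)) := by simpa [TwCert.rLoT] using hrlo
  have hrhi' : Real.exp (-(c.lamT D : ℝ)) ≤ ((c.rHiT D : ℚ) : ℝ) := by simpa [TwCert.rHiT] using hrhi
  have he0 : 0 ≤ Real.exp (-(c.lamT D : ℝ)) := (Real.exp_pos _).le
  set E := Real.exp (-(c.lamT D : ℝ)) * ((c.UqP D c.tableP.1.1 (n' + 1) : ℚ) : ℝ) with hE
  have hUB : E ≤ ((c.eUB D (n' + 1) : ℚ) : ℝ) := by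
    rw [TwCert.eUB]
    split_ifs with hs
    · push_cast
      have hu : ((c.UqP D c.tableP.1.1 (n' + 1) : ℚ) : ℝ) ≤ ((c.uHi (n' + 1) : ℚ) : ℝ) := by exact_mod_cast huh
      have hs' : (0 : ℝ) ≤ ((c.uHi (n' + 1) : ℚ) : ℝ) := by exact_mod_cast hs
      calc E ≤ Real.exp (-(c.lamT D : ℝ)) * ((c.uHi (n' + 1) : ℚ) : ℝ) := mul_le_mul_of_nonneg_left hu he0
        _ ≤ _ := mul_le_mul_of_nonneg_right hrhi' hs'
    · push_cast
      rw [not_le] at hs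
      have hu : ((c.UqP D c.tableP.1.1 (n' + 1) : ℚ) : ℝ) ≤ ((c.uHi (n' + 1) : ℚ) : ℝ) := by exact_mod_cast huh
      have hs' : ((c.uHi (n' + 1) : ℚ) : ℝ) ≤ 0 := by exact_mod_cast hs.le
      calc E ≤ Real.exp (-(c.lamT D : ℝ)) * ((c.uHi (n' + 1) : ℚ) : ℝ) := mul_le_mul_of_nonneg_left hu he0
        _ ≤ _ := by
          rw [mul_comm, mul_comm (((c.rLoT D : ℚ) : ℝ))]
          exact mul_le_mul_of_nonpos_left hrlo' hs'
  have hLB : ((c.eLB D (n' + 1) : ℚ) : ℝ) ≤ E := by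
    rw [TwCert.eLB]
    split_ifs with hs
    · push_cast
      have hu : ((c.uLo (n' + 1) : ℚ) : ℝ) ≤ ((c.UqP D c.tableP.1.1 (n' + 1) : ℚ) : ℝ) := by exact_mod_cast hul
      have hs' : (0 : ℝ) ≤ ((c.uLo (n' + 1) : ℚ) : ℝ) := by exact_mod_cast hs
      calc ((c.rLoT D : ℚ) : ℝ) * ((c.uLo (n' + 1) : ℚ) : ℝ)
          ≤ Real.exp (-(c.lamT D : ℝ)) * ((c.uLo (n' + 1) : ℚ) : ℝ) := mul_le_mul_of_nonneg_right hrlo' hs'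
        _ ≤ E := mul_le_mul_of_nonneg_left hu he0
    · push_cast
      rw [not_le] at hs
      have hu : ((c.uLo (n' + 1) : ℚ) : ℝ) ≤ ((c.UqP D c.tableP.1.1 (n' + 1) : ℚ) : ℝ) := by exact_mod_cast hul
      have hs' : ((c.uLo (n' + 1) : ℚ) : ℝ) ≤ 0 := by exact_mod_cast hs.le
      calc ((c.rHiT D : ℚ) : ℝ) * ((c.uLo (n' + 1) : ℚ) : ℝ)
          ≤ Real.exp (-(c.lamT D : ℝ)) * ((c.uLo (n' + 1) : ℚ) : ℝ) := by
            rw [mul_comm, mul_comm (Real.exp _)]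
            exact mul_le_mul_of_nonpos_left hrhi' hs'
        _ ≤ E := mul_le_mul_of_nonneg_left hu he0
  have hP1 : ((c.pLo (n' + 1) : ℚ) : ℝ) ≤ ((c.PqP D c.tableP.1.1 (n' + 1) : ℚ) : ℝ) := by exact_mod_cast hpl
  have hP2 : ((c.PqP D c.tableP.1.1 (n' + 1) : ℚ) : ℝ) ≤ ((c.pHi (n' + 1) : ℚ) : ℝ) := by exact_mod_cast hph
  rw [abs_le] at hblk
  obtain ⟨hb1, hb2⟩ := hblk
  constructor <;> linarith

end PrCert

end Specs

/-! ### Part 6d: the literal product-row object of `SrwTwistProductSliceBudget` in the `u`-form -/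

section Literal

/-- The Bessel function depends on the order through `|·|`. [cite: DLMF, 10.25.2] -/
theorem besselI_natAbs_index (z : ℤ) (x : ℝ) : besselI ((z.natAbs : ℕ) : ℤ) x = besselI z x := by
  simp [besselI, Literature.Probability.LatticeModels.besselITerm, Int.natAbs_abs]

/-- The class row at `c_j = 2π i^j Q_j/qden` is `(2π/qden)/2^a · Φ_a(u/2)` (the literal order `jm - (2s-a)`
has absolute value `cosOrd m a j s`). [cite: FitznerVanDerHofstad2016NoBLE, §5.1.1 (5.4)–(5.5) pp. 1089–1090] -/
theorem rowLit2_sum_eq (m J : ℕ) (Q : ℕ → ℤ) (qden a : ℕ) (u : ℝ) :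
    ∑ j ∈ Finset.range (J + 1), (if j = 0 then (1 : ℂ) else 2)
        * ((∑ s ∈ Finset.range (a + 1), ((a.choose s : ℂ) / 2 ^ a)
            * (besselI (j * (m : ℤ) - ((2 * (s : ℤ) - (a : ℕ) : ℤ))) u : ℂ))
          * (2 * π * Complex.I ^ j * (((Q j : ℝ) / (qden : ℝ) : ℝ) : ℂ)))
      = ((2 * π / (qden : ℝ) : ℝ) : ℂ) / 2 ^ a * twRowFun2 m J Q a (u / 2) := by
  have hidx : ∀ j s : ℕ, besselI ((j : ℤ) * (m : ℤ) - (2 * (s : ℤ) - ((a : ℕ) : ℤ))) u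
      = besselI ((cosOrd m a j s : ℕ) : ℤ) u := by
    intro j s
    rw [← natAbs_sub_eq_cosOrd, besselI_natAbs_index]
    congr 1; push_cast; ring
  rw [twRowFun2, Finset.mul_sum]
  refine sum_congr rfl fun j _ => ?_
  rw [Finset.mul_sum, Finset.sum_mul, Finset.mul_sum]
  refine sum_congr rfl fun s _ => ?_
  rw [hidx j s, ← epsN_cast, show 2 * (u / 2) = u by ring]
  push_cast
  ring

/-- The literal product over the coordinates is `(2π/qden)^{Σp}/2^A · ∏_r Φ_{a_r}(u/2)^{p_r}` when the
coordinate exponents unroll the class list. [cite: FitznerVanDerHofstad2016NoBLE, §5.1.1 (5.4)–(5.5) pp. 1089–1090] -/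
theorem rowLit2_prod_eq (m J : ℕ) (Q : ℕ → ℤ) (qden : ℕ) (cls : List (ℕ × ℕ)) {D : ℕ}
    (aa : Fin D → ℕ) (ha : List.ofFn aa = unroll cls) (u : ℝ) :
    ∏ μ, ∑ j ∈ Finset.range (J + 1), (if j = 0 then (1 : ℂ) else 2)
        * ((∑ s ∈ Finset.range (aa μ + 1), (((aa μ).choose s : ℂ) / 2 ^ (aa μ))
            * (besselI (j * (m : ℤ) - ((2 * (s : ℤ) - (aa μ : ℕ) : ℤ))) u : ℂ))
          * (2 * π * Complex.I ^ j * (((Q j : ℝ) / (qden : ℝ) : ℝ) : ℂ)))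
      = ((2 * π / (qden : ℝ) : ℝ) : ℂ) ^ psumL cls / 2 ^ asumL cls * prFFun m J Q (u / 2) cls := by
  have key := prod_fin_eq_cfold (fun a => ∑ j ∈ Finset.range (J + 1), (if j = 0 then (1 : ℂ) else 2)
        * ((∑ s ∈ Finset.range (a + 1), ((a.choose s : ℂ) / 2 ^ a)
            * (besselI (j * (m : ℤ) - ((2 * (s : ℤ) - (a : ℕ) : ℤ))) u : ℂ))
          * (2 * π * Complex.I ^ j * (((Q j : ℝ) / (qden : ℝ) : ℝ) : ℂ)))) cls aa ha
  beta_reduce at key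
  have hf : (fun a => ∑ j ∈ Finset.range (J + 1), (if j = 0 then (1 : ℂ) else 2)
        * ((∑ s ∈ Finset.range (a + 1), ((a.choose s : ℂ) / 2 ^ a)
            * (besselI (j * (m : ℤ) - ((2 * (s : ℤ) - (a : ℕ) : ℤ))) u : ℂ))
          * (2 * π * Complex.I ^ j * (((Q j : ℝ) / (qden : ℝ) : ℝ) : ℂ))))
      = fun a => ((2 * π / (qden : ℝ) : ℝ) : ℂ) / 2 ^ a * twRowFun2 m J Q a (u / 2) :=
    funext fun a => rowLit2_sum_eq m J Q qden a u
  rw [key, hf, cfold_div_two_pow, ← prFFun_eq_cfold]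

/-- Pointwise: `e^{-Du} Re ∏_μ (Σ_j ε_j W^{(a_μ)}_j(u) c_j) = (2π)^D Re Ψ_cls(u)` at `c_j = 2π i^j Q_j/qden`.
[cite: FitznerVanDerHofstad2016NoBLE, §5.1.1 (5.4)–(5.5) pp. 1089–1090] -/
theorem rowLit2_integrand (m J : ℕ) (Q : ℕ → ℤ) (qden : ℕ) (hq : 0 < qden) (cls : List (ℕ × ℕ)) {D : ℕ}
    (aa : Fin D → ℕ) (ha : List.ofFn aa = unroll cls) (hpD : psumL cls = D) (u : ℝ) :
    Real.exp (-((D : ℝ) * u)) *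
        (∏ μ, ∑ j ∈ Finset.range (J + 1), (if j = 0 then (1 : ℂ) else 2)
          * ((∑ s ∈ Finset.range (aa μ + 1), (((aa μ).choose s : ℂ) / 2 ^ (aa μ))
              * (besselI (j * (m : ℤ) - ((2 * (s : ℤ) - (aa μ : ℕ) : ℤ))) u : ℂ))
            * (2 * π * Complex.I ^ j * (((Q j : ℝ) / (qden : ℝ) : ℝ) : ℂ)))).re
      = (2 * π) ^ D * (prPsiP m J Q qden cls u).re := by
  have hq0 : (qden : ℝ) ≠ 0 := by exact_mod_cast hq.ne'
  rw [rowLit2_prod_eq m J Q qden cls aa ha u, re_prPsiP, hpD,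
    show ((2 * π / (qden : ℝ) : ℝ) : ℂ) ^ D / 2 ^ asumL cls
      = (((2 * π / (qden : ℝ)) ^ D / 2 ^ asumL cls : ℝ) : ℂ) by push_cast; ring,
    Complex.re_ofReal_mul, div_pow]
  field_simp

/-- **The literal product-row object in the `u`-form** (`τ = D u`):
`(1/n'!) ∫₀^∞ τ^{n'} e^{-τ} Re ∏_μ(Σ_j ε_j W^{(a_μ)}_j(τ/D) c_j) dτ / (2π)^D = D^{n'+1}/n'! ∫₀^∞ u^{n'} Re Ψ_cls(u) du`
at `c_j = 2π i^j Q_j/qden`. [cite: FitznerVanDerHofstad2016NoBLE, §5.1.1 (5.2)–(5.5) pp. 1089–1090] -/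
theorem rowLit2_eq_ublock (m J : ℕ) (Q : ℕ → ℤ) (qden : ℕ) (hq : 0 < qden) (cls : List (ℕ × ℕ)) {D : ℕ}
    (aa : Fin D → ℕ) (ha : List.ofFn aa = unroll cls) (hpD : psumL cls = D) (hD : 1 ≤ D) (n' : ℕ) :
    (n' ! : ℝ)⁻¹ * (∫ τ in Ioi (0:ℝ), τ ^ n' * (Real.exp (-τ) *
        (∏ μ, ∑ j ∈ Finset.range (J + 1), (if j = 0 then (1 : ℂ) else 2)
          * ((∑ s ∈ Finset.range (aa μ + 1), (((aa μ).choose s : ℂ) / 2 ^ (aa μ))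
              * (besselI (j * (m : ℤ) - ((2 * (s : ℤ) - (aa μ : ℕ) : ℤ))) (τ / D) : ℂ))
            * (2 * π * Complex.I ^ j * (((Q j : ℝ) / (qden : ℝ) : ℝ) : ℂ)))).re)) / (2 * π) ^ D
      = (D : ℝ) ^ (n' + 1) / (n' ! : ℝ) * ∫ u in Ioi (0:ℝ), u ^ n' * (prPsiP m J Q qden cls u).re := by
  have hD0 : (0 : ℝ) < D := by exact_mod_cast (by omega : 0 < D)
  have hπ : (0 : ℝ) < 2 * π := by positivity
  set g : ℝ → ℝ := fun u => ((D : ℝ) * u) ^ n' * ((2 * π) ^ D * (prPsiP m J Q qden cls u).re) with hg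
  have hint : (fun τ : ℝ => τ ^ n' * (Real.exp (-τ) *
        (∏ μ, ∑ j ∈ Finset.range (J + 1), (if j = 0 then (1 : ℂ) else 2)
          * ((∑ s ∈ Finset.range (aa μ + 1), (((aa μ).choose s : ℂ) / 2 ^ (aa μ))
              * (besselI (j * (m : ℤ) - ((2 * (s : ℤ) - (aa μ : ℕ) : ℤ))) (τ / D) : ℂ))
            * (2 * π * Complex.I ^ j * (((Q j : ℝ) / (qden : ℝ) : ℝ) : ℂ)))).re))
      = fun τ => g ((D : ℝ)⁻¹ * τ) := by
    funext τ
    have hu : (D : ℝ) * ((D : ℝ)⁻¹ * τ) = τ := by field_simp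
    rw [hg]
    beta_reduce
    rw [← rowLit2_integrand m J Q qden hq cls aa ha hpD ((D : ℝ)⁻¹ * τ), hu,
      show τ / (D : ℝ) = (D : ℝ)⁻¹ * τ by rw [div_eq_inv_mul]]
  rw [hint, integral_comp_mul_left_Ioi g 0 (inv_pos.mpr hD0)]
  simp only [mul_zero, inv_inv, smul_eq_mul]
  have hg' : g = fun u => ((D : ℝ) ^ n' * (2 * π) ^ D) * (u ^ n' * (prPsiP m J Q qden cls u).re) := by
    funext u; rw [hg, mul_pow]; ring
  rw [hg', integral_const_mul]
  have hπD : ((2 : ℝ) * π) ^ D ≠ 0 := pow_ne_zero _ hπ.ne'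
  have hn : (n' ! : ℝ) ≠ 0 := by positivity
  field_simp
  ring

end Literal

/-! ### Part 6e: integrability on `(0,∞)`, the split at `T`, and the assembly modulo the `[T,∞)` block -/

section Assembly

/-- `Ψ_a` is continuous. [cite: FitznerVanDerHofstad2016NoBLE, §5.1.1 (5.4)–(5.5) pp. 1089–1090] -/
theorem continuous_prPsi (m J : ℕ) (Q : ℕ → ℤ) (qden a : ℕ) : Continuous (prPsi m J Q qden a) := by
  unfold prPsi
  refine continuous_finsetSum _ fun j _ => continuous_finsetSum _ fun s _ => ?_
  exact continuous_const.mul (Complex.continuous_ofReal.comp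
    (Literature.Probability.LatticeModels.continuous_srwHeatKernel_left _))

/-- `Ψ_cls` is continuous. [cite: FitznerVanDerHofstad2016NoBLE, §5.1.1 (5.4)–(5.5) pp. 1089–1090] -/
theorem continuous_prPsiP (m J : ℕ) (Q : ℕ → ℤ) (qden : ℕ) (cls : List (ℕ × ℕ)) :
    Continuous (prPsiP m J Q qden cls) := by
  show Continuous (fun u => cfold (fun a => prPsi m J Q qden a u) cls)
  exact continuous_cfold (fun a => continuous_prPsi m J Q qden a) cls

/-- `‖Ψ_a(u)‖ ≤ (2J+1) q_u(0)` for `u ≥ 0` when `|Q_j| ≤ qden` (`Σ_s C(a,s) 2^{-a} = 1`). [cite: DLMF, 10.37] -/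
theorem norm_prPsi_le (m J : ℕ) (Q : ℕ → ℤ) (qden : ℕ) (hq : 0 < qden)
    (hQ : ∀ j, j ≤ J → (Q j).natAbs ≤ qden) (a : ℕ) {u : ℝ} (hu : 0 ≤ u) :
    ‖prPsi m J Q qden a u‖ ≤ (2 * J + 1) * srwHeatKernel u 0 := by
  unfold prPsi
  refine (norm_sum_le _ _).trans ?_
  rw [← sum_epsN, Finset.sum_mul]
  refine Finset.sum_le_sum fun j hj => ?_
  rw [Finset.mem_range] at hj
  have hq0 : (0 : ℝ) < qden := by exact_mod_cast hq
  have hQj : ‖((Q j : ℂ) / (qden : ℂ))‖ ≤ 1 := by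
    rw [norm_div, Complex.norm_intCast, Complex.norm_natCast, div_le_one hq0]
    have := hQ j (by omega)
    have h' : ((Q j).natAbs : ℝ) ≤ qden := by exact_mod_cast this
    rwa [Nat.cast_natAbs, Int.cast_abs] at h'
  have hterm : ∀ s ∈ Finset.range (a + 1),
      ‖(epsN j : ℂ) * Complex.I ^ j * ((Q j : ℂ) / (qden : ℂ))
          * ((((a.choose s : ℕ) : ℝ) / 2 ^ a : ℝ) : ℂ) * (srwHeatKernel u ((cosOrd m a j s : ℕ) : ℤ) : ℂ)‖
        ≤ (epsN j : ℝ) * (((a.choose s : ℕ) : ℝ) / 2 ^ a) * srwHeatKernel u 0 := by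
    intro s _
    have hk0 : 0 ≤ srwHeatKernel u ((cosOrd m a j s : ℕ) : ℤ) := srwHeatKernel_nonneg hu _
    have hk : srwHeatKernel u ((cosOrd m a j s : ℕ) : ℤ) ≤ srwHeatKernel u 0 := srwHeatKernel_le_zero_index hu _
    have hc0 : 0 ≤ ((a.choose s : ℕ) : ℝ) / 2 ^ a := by positivity
    rw [norm_mul, norm_mul, norm_mul, norm_mul, Complex.norm_natCast, norm_pow, Complex.norm_I, one_pow, mul_one,
      Complex.norm_real, Complex.norm_real, Real.norm_of_nonneg hc0, Real.norm_of_nonneg hk0]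
    calc (epsN j : ℝ) * ‖((Q j : ℂ) / (qden : ℂ))‖ * (((a.choose s : ℕ) : ℝ) / 2 ^ a)
          * srwHeatKernel u ((cosOrd m a j s : ℕ) : ℤ)
        ≤ (epsN j : ℝ) * 1 * (((a.choose s : ℕ) : ℝ) / 2 ^ a) * srwHeatKernel u 0 := by gcongr
      _ = _ := by rw [mul_one]
  refine (norm_sum_le _ _).trans ((Finset.sum_le_sum hterm).trans ?_)
  rw [← Finset.sum_mul, ← Finset.mul_sum, sum_choose_div_two_pow, mul_one]

/-- **Integrability of `uⁿ' Re Ψ_cls(u)` on `(0,∞)`** for `Σp = D ≥ 2n'+3`.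
[cite: FitznerVanDerHofstad2016NoBLE, §5.1.1 (5.2)–(5.4)] -/
theorem integrableOn_ublockP (m J : ℕ) (Q : ℕ → ℤ) (qden : ℕ) (hq : 0 < qden)
    (hQ : ∀ j, j ≤ J → (Q j).natAbs ≤ qden) (cls : List (ℕ × ℕ)) {D : ℕ} (hpD : psumL cls = D)
    (n' : ℕ) (hD : 2 * n' + 3 ≤ D) :
    IntegrableOn (fun u : ℝ => u ^ n' * (prPsiP m J Q qden cls u).re) (Ioi 0) := by
  have hcont : Continuous (fun u : ℝ => u ^ n' * (prPsiP m J Q qden cls u).re) :=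
    (continuous_pow n').mul (Complex.continuous_re.comp (continuous_prPsiP m J Q qden cls))
  have hdom := (integrableOn_pow_mul_srwHeatKernel_zero_pow_u n' hD).const_mul ((2 * J + 1 : ℝ) ^ D)
  refine Integrable.mono' hdom hcont.aestronglyMeasurable ?_
  rw [ae_restrict_iff' measurableSet_Ioi]
  refine Filter.Eventually.of_forall fun u (hu : 0 < u) => ?_
  have hk0 : 0 ≤ srwHeatKernel u 0 := srwHeatKernel_nonneg hu.le _
  have hB0 : (0 : ℝ) ≤ (2 * J + 1) * srwHeatKernel u 0 := mul_nonneg (by positivity) hk0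
  have hB := norm_cfold_le (fun a => prPsi m J Q qden a u) hB0 cls
    (fun ap _ => norm_prPsi_le m J Q qden hq hQ ap.1 hu.le)
  rw [hpD] at hB
  rw [norm_mul, norm_pow, Real.norm_eq_abs, abs_of_pos hu, Real.norm_eq_abs]
  calc u ^ n' * |(prPsiP m J Q qden cls u).re| ≤ u ^ n' * ‖prPsiP m J Q qden cls u‖ := by
        gcongr; exact Complex.abs_re_le_norm _
    _ ≤ u ^ n' * ((2 * J + 1) * srwHeatKernel u 0) ^ D := by gcongr; exact hB
    _ = (2 * J + 1 : ℝ) ^ D * (u ^ n' * srwHeatKernel u 0 ^ D) := by rw [mul_pow]; ring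

/-- The split `∫₀^∞ = ∫_{(0,T]} + ∫_{(T,∞)}` of the `u`-form. [cite: FitznerVanDerHofstad2016NoBLE, §5.1.1 (5.4)–(5.5) pp. 1089–1090] -/
theorem integral_ublockP_split (m J : ℕ) (Q : ℕ → ℤ) (qden : ℕ) (hq : 0 < qden)
    (hQ : ∀ j, j ≤ J → (Q j).natAbs ≤ qden) (cls : List (ℕ × ℕ)) {D : ℕ} (hpD : psumL cls = D)
    (n' : ℕ) (hD : 2 * n' + 3 ≤ D) {T : ℝ} (hT : 0 ≤ T) :
    ∫ u in Ioi 0, u ^ n' * (prPsiP m J Q qden cls u).re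
      = (∫ u in Ioc 0 T, u ^ n' * (prPsiP m J Q qden cls u).re)
        + ∫ u in Ioi T, u ^ n' * (prPsiP m J Q qden cls u).re := by
  have hint := integrableOn_ublockP m J Q qden hq hQ cls hpD n' hD
  rw [← Ioc_union_Ioi_eq_Ioi hT, setIntegral_union Ioc_disjoint_Ioi_same measurableSet_Ioi
    (hint.mono_set Ioc_subset_Ioi_self) (hint.mono_set (Ioi_subset_Ioi hT))]

namespace PrCert

variable (c : PrCert) (D : ℕ)

/-- The `[T,∞)` block statement (divided by the prefactor): `tailLo_n ≤ ∫_T^∞ u^{n'} Re Ψ_cls ≤ tailHi_n`,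
`n = n'+1`. [cite: FitznerVanDerHofstad2016NoBLE, §5.1.1 (5.4)–(5.5) pp. 1089–1090] -/
def IoiBlockP (n' : ℕ) : Prop :=
  ((c.tailLo D (n' + 1) : ℚ) : ℝ)
      ≤ ∫ u in Ioi ((c.t : ℝ) ^ 2), u ^ n' * (prPsiP c.m c.J c.Q c.qden c.cls u).re ∧
  ∫ u in Ioi ((c.t : ℝ) ^ 2), u ^ n' * (prPsiP c.m c.J c.Q c.qden c.cls u).re
      ≤ ((c.tailHi D (n' + 1) : ℚ) : ℝ)

/-- **Soundness of the product SEEDCERT modulo the `[T,∞)` block**: if `checkP` holds and the tail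
block brackets `IoiBlockP` hold for `n' ≤ 3`, then for `1 ≤ n ≤ 4` and every coordinate assignment
unrolling the class list the literal product-row object at `c_j = 2π i^j Q_j/qden` lies in `[lo n, hi n]`.
[cite: FitznerVanDerHofstad2016NoBLE, §5.1.1 (5.2)–(5.5) pp. 1089–1090] -/
theorem soundP_of_ioiBlockP (h : c.checkP D = true) (htail : ∀ n', n' ≤ 3 → c.IoiBlockP D n')
    (a : Fin D → ℕ) (ha : List.ofFn a = unroll c.cls) (n : ℕ) (hn1 : 1 ≤ n) (hn4 : n ≤ 4) :
    ((c.lo n : ℚ) : ℝ)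
        ≤ ((n - 1) ! : ℝ)⁻¹ * (∫ τ in Ioi (0:ℝ), τ ^ (n - 1) * (Real.exp (-τ) *
            (∏ μ, ∑ j ∈ Finset.range (c.J + 1), (if j = 0 then (1 : ℂ) else 2)
              * ((∑ s ∈ Finset.range (a μ + 1), (((a μ).choose s : ℂ) / 2 ^ (a μ))
                  * (besselI (j * (c.m : ℤ) - ((2 * (s : ℤ) - (a μ : ℕ) : ℤ))) (τ / D) : ℂ))
                * c.cT j)).re)) / (2 * π) ^ D ∧
    ((n - 1) ! : ℝ)⁻¹ * (∫ τ in Ioi (0:ℝ), τ ^ (n - 1) * (Real.exp (-τ) *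
            (∏ μ, ∑ j ∈ Finset.range (c.J + 1), (if j = 0 then (1 : ℂ) else 2)
              * ((∑ s ∈ Finset.range (a μ + 1), (((a μ).choose s : ℂ) / 2 ^ (a μ))
                  * (besselI (j * (c.m : ℤ) - ((2 * (s : ℤ) - (a μ : ℕ) : ℤ))) (τ / D) : ℂ))
                * c.cT j)).re)) / (2 * π) ^ D
        ≤ ((c.hi n : ℚ) : ℝ) := by
  obtain ⟨h1, h4, h2, _h3, _h5⟩ := c.checkP_spec D h
  have hp := c.paramsP_of_paramsOKP D h1
  obtain ⟨n', rfl⟩ : ∃ n', n = n' + 1 := ⟨n - 1, by omega⟩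
  have hn : n' ≤ 3 := by omega
  have hD1 : 1 ≤ D := le_trans (by norm_num) hp.toT.hD
  have hD3 : 2 * n' + 3 ≤ D := by have := hp.toT.hD; omega
  have hpD : psumL c.cls = D := by rw [← c.psum_eq_psumL]; exact hp.psum_eq
  have hT : (0 : ℝ) ≤ (c.t : ℝ) ^ 2 := by positivity
  simp only [Nat.add_sub_cancel, TwCert.cT]
  rw [rowLit2_eq_ublock c.m c.J c.Q c.qden hp.toT.qden_pos c.cls a ha hpD hD1 n',
    integral_ublockP_split c.m c.J c.Q c.qden hp.toT.qden_pos hp.toT.Q_le c.cls hpD n' hD3 hT, mul_add]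
  obtain ⟨hB0lo, hB0hi⟩ := c.ioc_blockP_bracket D hp h2 n' hn
  obtain ⟨hB1lo, hB1hi⟩ := htail n' hn
  obtain ⟨_, hlo, hhi⟩ := c.toTwCert.finalCheckT_spec D h4 (n' + 1) (by omega) (by omega)
  have qlo : ((c.lo (n' + 1) : ℚ) : ℝ) ≤ ((c.loFinalT D (n' + 1) : ℚ) : ℝ) := by exact_mod_cast hlo
  have qhi : ((c.hiFinalT D (n' + 1) : ℚ) : ℝ) ≤ ((c.hi (n' + 1) : ℚ) : ℝ) := by exact_mod_cast hhi
  rw [TwCert.loFinalT] at qlo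
  rw [TwCert.hiFinalT] at qhi
  push_cast at qlo qhi
  rw [TwCert.cast_prefD] at qlo qhi
  have hpref0 : (0 : ℝ) ≤ (D : ℝ) ^ (n' + 1) / (n' ! : ℝ) := by positivity
  have hC := mul_le_mul_of_nonneg_left hB1lo hpref0
  have hD' := mul_le_mul_of_nonneg_left hB1hi hpref0
  constructor <;> linarith

end PrCert

end Assembly

/-! ### Part 6c-i: semantics of the `[T,∞)` lists of the product kernel -/

section TailSem2

open Polynomial

/-- `W_a(u) = Σ_j Σ_s ε_j i^j (Q_j/qden) C(a,s) 2^{-a} √(2πu) q_u(|jm+a-2s|)` (the class factor of the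
`[T,∞)` integrand). [cite: FitznerVanDerHofstad2016NoBLE, §5.1.1 (5.4)–(5.5) pp. 1089–1090] -/
noncomputable def prW (m J : ℕ) (Q : ℕ → ℤ) (qden a : ℕ) (u : ℝ) : ℂ :=
  ∑ j ∈ range (J + 1), ∑ s ∈ range (a + 1), (epsN j : ℂ) * Complex.I ^ j * ((Q j : ℂ) / (qden : ℂ))
    * ((((a.choose s : ℕ) : ℝ) / 2 ^ a : ℝ) : ℂ)
    * ((√(2 * π * u) * srwHeatKernel u ((cosOrd m a j s : ℕ) : ℤ) : ℝ) : ℂ)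

/-- `P_a(w) = Σ_j Σ_s ε_j i^j (Q_j/qden) C(a,s) 2^{-a} Mid_{|jm+a-2s|}(w)` (the class main polynomial).
[cite: FitznerVanDerHofstad2016NoBLE, §5.1.1 (5.4)–(5.5) pp. 1089–1090] -/
noncomputable def prP (m J Jb : ℕ) (Q : ℕ → ℤ) (qden a : ℕ) (w : ℝ) : ℂ :=
  ∑ j ∈ range (J + 1), ∑ s ∈ range (a + 1), (epsN j : ℂ) * Complex.I ^ j * ((Q j : ℂ) / (qden : ℂ))
    * ((((a.choose s : ℕ) : ℝ) / 2 ^ a : ℝ) : ℂ)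
    * (((toPolyQ (midList (cosOrd m a j s) Jb)).eval w : ℝ) : ℂ)

/-- `W_a(u) = √(2πu) Ψ_a(u)`. [cite: FitznerVanDerHofstad2016NoBLE, §5.1.1 (5.4)–(5.5) pp. 1089–1090] -/
theorem prW_eq (m J : ℕ) (Q : ℕ → ℤ) (qden a : ℕ) (u : ℝ) :
    prW m J Q qden a u = ((√(2 * π * u) : ℝ) : ℂ) * prPsi m J Q qden a u := by
  rw [prW, prPsi, mul_sum]
  refine sum_congr rfl fun j _ => ?_
  rw [mul_sum]
  refine sum_congr rfl fun s _ => ?_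
  push_cast
  ring

/-- `Π W_a^{p_a} = √(2πu)^{Σp} Ψ`. [cite: FitznerVanDerHofstad2016NoBLE, §5.1.1 (5.4)–(5.5) pp. 1089–1090] -/
theorem cfold_prW_eq (m J : ℕ) (Q : ℕ → ℤ) (qden : ℕ) (cls : List (ℕ × ℕ)) (u : ℝ) :
    cfold (fun a => prW m J Q qden a u) cls
      = ((√(2 * π * u) : ℝ) : ℂ) ^ psumL cls * prPsiP m J Q qden cls u := by
  rw [prPsiP, ← cfold_const, ← cfold_mul]
  exact cfold_congr cls fun ap _ => prW_eq m J Q qden ap.1 u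

/-- The `[T,∞)` integrand identity `u^{n'} Re Ψ(u) = (2π)^{-D/2} u^{n'-D/2} Re Π W_a(u)^{p_a}` (`u > 0`).
[cite: FitznerVanDerHofstad2016NoBLE, §5.1.1 (5.4)–(5.5) pp. 1089–1090] -/
theorem integrand_eqP (m J : ℕ) (Q : ℕ → ℤ) (qden : ℕ) (cls : List (ℕ × ℕ)) {D : ℕ}
    (hpD : psumL cls = D) (n' : ℕ) {u : ℝ} (hu : 0 < u) :
    u ^ n' * (prPsiP m J Q qden cls u).re
      = ((√(2 * π)) ^ D)⁻¹ * (u ^ n' / (√u) ^ D) * (cfold (fun a => prW m J Q qden a u) cls).re := by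
  have hs : √(2 * π * u) = √(2 * π) * √u := by rw [Real.sqrt_mul (by positivity)]
  have hs0 : 0 < √(2 * π * u) := Real.sqrt_pos.mpr (by positivity)
  have hΨ : prPsiP m J Q qden cls u
      = ((((√(2 * π * u))⁻¹) ^ D : ℝ) : ℂ) * cfold (fun a => prW m J Q qden a u) cls := by
    rw [cfold_prW_eq, hpD, ← mul_assoc, ← Complex.ofReal_pow, ← Complex.ofReal_mul, ← mul_pow,
      inv_mul_cancel₀ hs0.ne', one_pow, Complex.ofReal_one, one_mul]
  rw [hΨ, Complex.re_ofReal_mul, hs, inv_pow, mul_pow]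
  have h1 : (√(2 * π)) ^ D ≠ 0 := pow_ne_zero _ (Real.sqrt_pos.mpr (by positivity)).ne'
  have h2 : (√u) ^ D ≠ 0 := pow_ne_zero _ (Real.sqrt_pos.mpr hu).ne'
  field_simp

/-- The orders `|jm+a-2s| ≤ jm + a` (`s ≤ a`). [cite: FitznerVanDerHofstad2016NoBLE, §5.1.1 (5.4)–(5.5) pp. 1089–1090] -/
theorem cosOrd_le (m a j s : ℕ) (hs : s ≤ a) : cosOrd m a j s ≤ j * m + a := by
  unfold cosOrd; split_ifs <;> omega

/-- Lengths of `wTermGZ2 j s` are `≤ ℓ`. [cite: FitznerVanDerHofstad2016NoBLE, §5.1.1 (5.4)–(5.5) pp. 1089–1090] -/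
theorem wTermGZ2_le (Jb S ℓ m a : ℕ) (Q : ℕ → ℤ) (j s : ℕ) (hℓ : blen (cosOrd m a j s) Jb ≤ ℓ) :
    GZle (wTermGZ2 Jb S ℓ m a Q j s) ℓ := by
  have hz : (midListZ (cosOrd m a j s) Jb S ℓ).length = ℓ := length_midListZ _ _ _ _ hℓ
  have hb1 : ∀ c, (smulPN c (pnOfZ (midListZ (cosOrd m a j s) Jb S ℓ))).1.length = ℓ := fun c => by
    simp [smulPN, pnOfZ, length_smulN, length_posOfZ, hz]
  have hb2 : ∀ c, (smulPN c (pnOfZ (midListZ (cosOrd m a j s) Jb S ℓ))).2.length = ℓ := fun c => by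
    simp [smulPN, pnOfZ, length_smulN, length_negOfZ, hz]
  unfold wTermGZ2 GZle
  split_ifs <;> cases (xor (decide (Q j < 0)) (decide (2 ≤ j % 4))) <;>
    simp [negPN, hb1, hb2, zeroPN]

/-- Lengths of `gzP2` are `≤ ℓ` once every order's bracket list fits. [cite: FitznerVanDerHofstad2016NoBLE, §5.1.1 (5.4)–(5.5) pp. 1089–1090] -/
theorem gzP2_le (Jb S ℓ m a J : ℕ) (Q : ℕ → ℤ)
    (hℓ : ∀ j s, j ≤ J → s ≤ a → blen (cosOrd m a j s) Jb ≤ ℓ) : GZle (gzP2 Jb S ℓ m a J Q) ℓ := by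
  have hs : GZle (gzSum (fun i => wTermGZ2 Jb S ℓ m a Q (i / (a + 1)) (i % (a + 1))) ((J + 1) * (a + 1))
      (zeroPN ℓ, zeroPN ℓ)) ℓ :=
    gzSum_le _ ℓ ((J + 1) * (a + 1)) _ (fun i hi => wTermGZ2_le Jb S ℓ m a Q _ _
        (hℓ _ _ (by have := (Nat.div_lt_iff_lt_mul (by omega : 0 < a + 1)).mpr hi; omega)
          (by have := Nat.mod_lt i (by omega : 0 < a + 1); omega)))
      ⟨by simp [zeroPN], by simp [zeroPN], by simp [zeroPN], by simp [zeroPN]⟩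
  obtain ⟨h1, h2, h3, h4⟩ := hs
  obtain ⟨n1, n2⟩ := length_normPN (gzSum (fun i => wTermGZ2 Jb S ℓ m a Q (i / (a + 1)) (i % (a + 1)))
    ((J + 1) * (a + 1)) (zeroPN ℓ, zeroPN ℓ)).1
  obtain ⟨n3, n4⟩ := length_normPN (gzSum (fun i => wTermGZ2 Jb S ℓ m a Q (i / (a + 1)) (i % (a + 1)))
    ((J + 1) * (a + 1)) (zeroPN ℓ, zeroPN ℓ)).2
  unfold gzP2 GZle
  simp only [forcePN_eq]
  rw [n1, n2, n3, n4]
  exact ⟨max_le h1 h2, max_le h1 h2, max_le h3 h4, max_le h3 h4⟩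

/-- Values of `wTermGZ2 j s`: real part `= reSign j · ε_j C(a,s) Q_j · 2^S Mid[k]`, imaginary part with `imSign j`.
[cite: FitznerVanDerHofstad2016NoBLE, §5.1.1 (5.4)–(5.5) pp. 1089–1090] -/
theorem zval_wTermGZ2 (Jb S ℓ m a : ℕ) (Q : ℕ → ℤ) (j s k : ℕ) :
    zval (wTermGZ2 Jb S ℓ m a Q j s).1 k
        = reSign j * ((epsN j : ℤ) * (a.choose s : ℤ) * Q j) * (midListZ (cosOrd m a j s) Jb S ℓ).getD k 0 ∧
      zval (wTermGZ2 Jb S ℓ m a Q j s).2 k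
        = imSign j * ((epsN j : ℤ) * (a.choose s : ℤ) * Q j) * (midListZ (cosOrd m a j s) Jb S ℓ).getD k 0 := by
  have key : ∀ b : Bool, zval (bif b then
        negPN (smulPN (cosW a Q j s) (pnOfZ (midListZ (cosOrd m a j s) Jb S ℓ)))
      else smulPN (cosW a Q j s) (pnOfZ (midListZ (cosOrd m a j s) Jb S ℓ))) k
      = (if b then -1 else 1) * ((cosW a Q j s : ℕ) : ℤ) * (midListZ (cosOrd m a j s) Jb S ℓ).getD k 0 := by
    intro b
    cases b <;> simp only [Bool.false_eq_true, if_true, if_false, cond_true,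
      cond_false, zval_negPN, zval_smulPN, zval_pnOfZ] <;> ring
  have hrt : ∀ z : ℤ, (if xor (decide (Q j < 0)) (decide (2 ≤ j % 4)) then -1 else 1)
      * ((cosW a Q j s : ℕ) : ℤ) * z
      = (if 2 ≤ j % 4 then -1 else 1) * ((epsN j : ℤ) * (a.choose s : ℤ) * Q j) * z := by
    intro z
    have := rtSign_mul_cabs Q j (epsN j * a.choose s)
    unfold rtSign at this
    rw [cosW_eq, this]
    push_cast
    ring
  unfold wTermGZ2
  by_cases hj : j % 2 = 0
  · simp only [hj, if_true]
    refine ⟨?_, ?_⟩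
    · rw [key, hrt]; unfold reSign; rw [if_pos hj]
    · rw [zval_zeroPN]; unfold imSign; rw [if_pos hj]; simp
  · simp only [hj, if_false]
    refine ⟨?_, ?_⟩
    · rw [zval_zeroPN]; unfold reSign; rw [if_neg hj]; simp
    · rw [key, hrt]; unfold imSign; rw [if_neg hj]

/-- Coefficients of `cPoly (wTermGZ2 j s)`: `ε_j Q_j i^j C(a,s) · 2^S Mid_{|jm+a-2s|}[k]`.
[cite: FitznerVanDerHofstad2016NoBLE, §5.1.1 (5.4)–(5.5) pp. 1089–1090] -/
theorem coeff_cPoly_wTermGZ2 (Jb S ℓ m a : ℕ) (Q : ℕ → ℤ) (j s k : ℕ) :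
    (cPoly (wTermGZ2 Jb S ℓ m a Q j s)).coeff k
      = ((epsN j : ℂ) * (Q j : ℂ) * Complex.I ^ j * ((a.choose s : ℕ) : ℂ))
        * (((midListZ (cosOrd m a j s) Jb S ℓ).getD k 0 : ℤ) : ℂ) := by
  obtain ⟨h1, h2⟩ := zval_wTermGZ2 Jb S ℓ m a Q j s k
  rw [coeff_cPoly, h1, h2, I_pow_eq]
  push_cast
  ring

/-- `cPoly (gzP2)` as a double sum of scaled bracket polynomials. [cite: FitznerVanDerHofstad2016NoBLE, §5.1.1 (5.4)–(5.5) pp. 1089–1090] -/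
theorem cPoly_gzP2 (Jb S ℓ m a J : ℕ) (Q : ℕ → ℤ) :
    cPoly (gzP2 Jb S ℓ m a J Q) = ∑ j ∈ range (J + 1), ∑ s ∈ range (a + 1),
      C ((epsN j : ℂ) * (Q j : ℂ) * Complex.I ^ j * ((a.choose s : ℕ) : ℂ))
        * (toPolyZ (midListZ (cosOrd m a j s) Jb S ℓ)).map Complex.ofRealHom := by
  refine Polynomial.ext fun k => ?_
  obtain ⟨h1, h2⟩ := zval_gzSum (fun i => wTermGZ2 Jb S ℓ m a Q (i / (a + 1)) (i % (a + 1))) k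
    ((J + 1) * (a + 1)) (zeroPN ℓ, zeroPN ℓ)
  have e1 := sum_flat (fun j s => zval (wTermGZ2 Jb S ℓ m a Q j s).1 k) a (J + 1)
  have e2 := sum_flat (fun j s => zval (wTermGZ2 Jb S ℓ m a Q j s).2 k) a (J + 1)
  beta_reduce at e1 e2
  rw [coeff_cPoly, finsetSum_coeff]
  unfold gzP2
  simp only [forcePN_eq, zval_normPN]
  rw [h1, h2, zval_zeroPN, zero_add, zero_add, e1, e2]
  push_cast
  rw [mul_sum, ← sum_add_distrib]
  refine sum_congr rfl fun j _ => ?_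
  rw [finsetSum_coeff, mul_sum, ← sum_add_distrib]
  refine sum_congr rfl fun s _ => ?_
  rw [← coeff_cPoly, coeff_cPoly_wTermGZ2, coeff_C_mul, coeff_map, coeff_toPolyZ]
  simp

/-- `cPoly (gzP2)(w) = (2^S qden 2^a) · P_a(w)` once the bracket coefficients are `S`-dyadic.
[cite: FitznerVanDerHofstad2016NoBLE, §5.1.1 (5.4)–(5.5) pp. 1089–1090] -/
theorem eval_cPoly_gzP2 (Jb S ℓ m a J : ℕ) (Q : ℕ → ℤ) (qden : ℕ) (hq : 0 < qden)
    (hdy : ∀ j s, j ≤ J → s ≤ a → ∀ q ∈ midList (cosOrd m a j s) Jb, dyadicOK S q = true) (w : ℝ) :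
    (cPoly (gzP2 Jb S ℓ m a J Q)).eval (w : ℂ)
      = (2 : ℂ) ^ S * (qden : ℂ) * 2 ^ a * prP m J Jb Q qden a w := by
  rw [cPoly_gzP2, eval_finsetSum, prP, mul_sum]
  refine sum_congr rfl fun j hj => ?_
  have hjJ : j ≤ J := by have := mem_range.mp hj; omega
  rw [eval_finsetSum, mul_sum]
  refine sum_congr rfl fun s hs => ?_
  have hsa : s ≤ a := by have := mem_range.mp hs; omega
  rw [eval_mul, eval_C, eval_map, show (w : ℂ) = Complex.ofRealHom w from rfl, eval₂_at_apply,
    toPolyZ_midListZ _ _ _ _ (hdy j s hjJ hsa), eval_mul, eval_C]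
  have hq0 : (qden : ℂ) ≠ 0 := by exact_mod_cast hq.ne'
  have h2 : (2 : ℂ) ^ a ≠ 0 := pow_ne_zero _ two_ne_zero
  simp only [Complex.ofRealHom_eq_coe, Complex.ofReal_mul, Complex.ofReal_pow, Complex.ofReal_ofNat,
    Complex.ofReal_div, Complex.ofReal_natCast]
  field_simp

/-- The fold invariant of `gzWProdAux`: `cPoly` multiplies by `Π cPoly(gzP2 a)^{p}`, lengths stay controlled.
[cite: FitznerVanDerHofstad2016NoBLE, §5.1.1 (5.4)–(5.5) pp. 1089–1090] -/
theorem cPoly_gzWProdAux (Jb S ℓ m J : ℕ) (Q : ℕ → ℤ) (hℓ : 1 ≤ ℓ) :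
    ∀ (t : List (ℕ × ℕ)) (acc : GZ) (len : ℕ), (∀ ap ∈ t, 1 ≤ ap.2) →
      (∀ ap ∈ t, GZle (gzP2 Jb S ℓ m ap.1 J Q) ℓ) → GZle acc len → 1 ≤ len →
      cPoly (gzWProdAux Jb S ℓ m J Q acc len t).1
          = cPoly acc * cfold (fun a => cPoly (gzP2 Jb S ℓ m a J Q)) t ∧
        GZle (gzWProdAux Jb S ℓ m J Q acc len t).1 (gzWProdAux Jb S ℓ m J Q acc len t).2 ∧
        (gzWProdAux Jb S ℓ m J Q acc len t).2 = len + psumL t * (ℓ - 1)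
  | [], acc, len, _, _, hacc, _ => by simp [gzWProdAux, psumL, hacc]
  | (a, p) :: t, acc, len, hps, hle, hacc, hlen => by
      have hp : 1 ≤ p := hps (a, p) List.mem_cons_self
      have hX : GZle (gzP2 Jb S ℓ m a J Q) ℓ := hle (a, p) List.mem_cons_self
      obtain ⟨hpow, hpowle⟩ := cPoly_gzPowW ℓ hℓ _ hX p hp
      have hmul : cPoly (gzMulW (len + p * (ℓ - 1)) acc (gzPowW ℓ (gzP2 Jb S ℓ m a J Q) p))
          = cPoly acc * cPoly (gzP2 Jb S ℓ m a J Q) ^ p := by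
        rw [cPoly_gzMulW (len + p * (ℓ - 1)) len (p * (ℓ - 1) + 1) _ _ hacc hpowle (by omega) (by omega)
          (by omega), hpow]
      obtain ⟨h1, h2, h3⟩ := cPoly_gzWProdAux Jb S ℓ m J Q hℓ t
        (gzMulW (len + p * (ℓ - 1)) acc (gzPowW ℓ (gzP2 Jb S ℓ m a J Q) p)) (len + p * (ℓ - 1))
        (fun ap hap => hps ap (List.mem_cons_of_mem _ hap))
        (fun ap hap => hle ap (List.mem_cons_of_mem _ hap)) (GZle.of_len (gzMulW_len _ _ _)) (by omega)
      simp only [gzWProdAux]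
      refine ⟨?_, h2, ?_⟩
      · rw [h1, hmul, cfold_cons, mul_assoc]
      · rw [h3, psumL_cons]; ring

/-- **`cPoly (gzWProd cls) = Π_a cPoly(gzP2 a)^{p_a}`** with lengths `≤ Σp(ℓ-1)+1`.
[cite: FitznerVanDerHofstad2016NoBLE, §5.1.1 (5.4)–(5.5) pp. 1089–1090] -/
theorem cPoly_gzWProd (Jb S ℓ m J : ℕ) (Q : ℕ → ℤ) (hℓ : 1 ≤ ℓ) (cls : List (ℕ × ℕ)) (hne : cls ≠ [])
    (hps : ∀ ap ∈ cls, 1 ≤ ap.2) (hle : ∀ ap ∈ cls, GZle (gzP2 Jb S ℓ m ap.1 J Q) ℓ) :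
    cPoly (gzWProd Jb S ℓ m J Q cls).1 = cfold (fun a => cPoly (gzP2 Jb S ℓ m a J Q)) cls ∧
      GZle (gzWProd Jb S ℓ m J Q cls).1 (psumL cls * (ℓ - 1) + 1) := by
  obtain ⟨ap, t, rfl⟩ : ∃ ap t, cls = ap :: t := by
    cases cls with
    | nil => exact absurd rfl hne
    | cons ap t => exact ⟨ap, t, rfl⟩
  obtain ⟨a, p⟩ := ap
  have hp : 1 ≤ p := hps (a, p) List.mem_cons_self
  have hX : GZle (gzP2 Jb S ℓ m a J Q) ℓ := hle (a, p) List.mem_cons_self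
  obtain ⟨hpow, hpowle⟩ := cPoly_gzPowW ℓ hℓ _ hX p hp
  obtain ⟨h1, h2, h3⟩ := cPoly_gzWProdAux Jb S ℓ m J Q hℓ t (gzPowW ℓ (gzP2 Jb S ℓ m a J Q) p)
    (p * (ℓ - 1) + 1) (fun ap hap => hps ap (List.mem_cons_of_mem _ hap))
    (fun ap hap => hle ap (List.mem_cons_of_mem _ hap)) hpowle (by omega)
  rw [gzWProd]
  refine ⟨by rw [h1, hpow, cfold_cons], ?_⟩
  have hlen : (gzWProdAux Jb S ℓ m J Q (gzPowW ℓ (gzP2 Jb S ℓ m a J Q) p) (p * (ℓ - 1) + 1) t).2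
      = psumL ((a, p) :: t) * (ℓ - 1) + 1 := by
    rw [h3, psumL_cons]; ring
  rw [← hlen]
  exact h2

/-- Exact lengths along the fold (needed for `tailInt`). [cite: FitznerVanDerHofstad2016NoBLE, §5.1.1 (5.4)–(5.5) pp. 1089–1090] -/
theorem gzWProdAux_len (Jb S ℓ m J : ℕ) (Q : ℕ → ℤ) :
    ∀ (t : List (ℕ × ℕ)) (acc : GZ) (len : ℕ), t ≠ [] →
      GZlen (gzWProdAux Jb S ℓ m J Q acc len t).1 (gzWProdAux Jb S ℓ m J Q acc len t).2
  | [], _, _, h => absurd rfl h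
  | (a, p) :: t, acc, len, _ => by
      simp only [gzWProdAux]
      by_cases ht : t = []
      · subst ht
        simp only [gzWProdAux]
        exact gzMulW_len _ _ _
      · exact gzWProdAux_len Jb S ℓ m J Q t _ _ ht

/-- Exact lengths of `gzWProd cls` (`cls ≠ []`, `Σ p ≥ 2`). [cite: FitznerVanDerHofstad2016NoBLE, §5.1.1 (5.4)–(5.5) pp. 1089–1090] -/
theorem gzWProd_len (Jb S ℓ m J : ℕ) (Q : ℕ → ℤ) :
    ∀ cls : List (ℕ × ℕ), cls ≠ [] → 2 ≤ psumL cls →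
      GZlen (gzWProd Jb S ℓ m J Q cls).1 (gzWProd Jb S ℓ m J Q cls).2
  | [], h, _ => absurd rfl h
  | [(a, p)], _, h2 => by
      have hp : 2 ≤ p := by simpa [psumL] using h2
      simp only [gzWProd, gzWProdAux]
      exact gzPowW_len ℓ _ p hp
  | (a, p) :: b :: t, _, _ => by
      rw [gzWProd]
      exact gzWProdAux_len Jb S ℓ m J Q (b :: t) _ _ (List.cons_ne_nil _ _)

namespace PrCert

variable (c : PrCert) (D : ℕ)

/-- Exponents are at most `amax`. [cite: FitznerVanDerHofstad2016NoBLE, §5.1.1 (5.4)–(5.5) pp. 1089–1090] -/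
theorem le_amax {ap : ℕ × ℕ} (hap : ap ∈ c.cls) : ap.1 ≤ c.amax :=
  le_maxN_of_mem (List.mem_map.mpr ⟨ap, hap, rfl⟩)

/-- Every Bessel order of the classes is at most `maxOrd = Jm + amax`. [cite: FitznerVanDerHofstad2016NoBLE, §5.1.1 (5.4)–(5.5) pp. 1089–1090] -/
theorem cosOrd_le_maxOrd {ap : ℕ × ℕ} (hap : ap ∈ c.cls) {j s : ℕ} (hj : j ≤ c.J) (hs : s ≤ ap.1) :
    cosOrd c.m ap.1 j s ≤ c.maxOrd := by
  have h1 := cosOrd_le c.m ap.1 j s hs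
  have h2 := Nat.mul_le_mul_right c.m hj
  have h3 := c.le_amax hap
  unfold PrCert.maxOrd
  omega

/-- Every order's bracket list fits in `lw2`. [cite: FitznerVanDerHofstad2016NoBLE, §5.1.1 (5.4)–(5.5) pp. 1089–1090] -/
theorem blen_cosOrd_le {ap : ℕ × ℕ} (hap : ap ∈ c.cls) {j s : ℕ} (hj : j ≤ c.J) (hs : s ≤ ap.1) :
    blen (cosOrd c.m ap.1 j s) c.Jb ≤ c.lw2 := by
  have := c.cosOrd_le_maxOrd hap hj hs
  unfold PrCert.lw2 blen
  omega

/-- Exact lengths of `powRe2`. [cite: FitznerVanDerHofstad2016NoBLE, §5.1.1 (5.4)–(5.5) pp. 1089–1090] -/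
theorem powRe2_len (hp : c.ParamsP D) : c.powRe2.1.length = c.powRe2.2.length := by
  have h2 : 2 ≤ psumL c.cls := by rw [← c.psum_eq_psumL, hp.psum_eq]; have := hp.toT.hD; omega
  obtain ⟨h1, h2, -, -⟩ := gzWProd_len c.Jb c.S c.lw2 c.m c.J c.Q c.cls hp.ne h2
  change ((gzWProd c.Jb c.S c.lw2 c.m c.J c.Q c.cls).1).1.1.length
    = ((gzWProd c.Jb c.S c.lw2 c.m c.J c.Q c.cls).1).1.2.length
  rw [h1, h2]

/-- **`pnPoly powRe2 (w) = (2^S qden)^D 2^A · Re Π_a P_a(w)^{p_a}`**. [cite: FitznerVanDerHofstad2016NoBLE, §5.1.1 (5.4)–(5.5) pp. 1089–1090] -/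
theorem powRe2_eval (hp : c.ParamsP D) (w : ℝ) :
    (pnPoly c.powRe2).eval w
      = (((2 : ℝ) ^ c.S * c.qden) ^ D * 2 ^ c.asum)
        * (cfold (fun a => prP c.m c.J c.Jb c.Q c.qden a w) c.cls).re := by
  have hlw : 1 ≤ c.lw2 := by unfold PrCert.lw2 blen; omega
  have hle : ∀ ap ∈ c.cls, GZle (gzP2 c.Jb c.S c.lw2 c.m ap.1 c.J c.Q) c.lw2 := fun ap hap =>
    gzP2_le _ _ _ _ _ _ _ (fun j s hj hs => c.blen_cosOrd_le hap hj hs)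
  obtain ⟨hprod, -⟩ := cPoly_gzWProd c.Jb c.S c.lw2 c.m c.J c.Q hlw c.cls hp.ne hp.p_pos hle
  have hev : (pnPoly c.powRe2).eval w
      = (cfold (fun a => (cPoly (gzP2 c.Jb c.S c.lw2 c.m a c.J c.Q)).eval (w : ℂ)) c.cls).re := by
    have h : ((cPoly (gzWProd c.Jb c.S c.lw2 c.m c.J c.Q c.cls).1).eval (w : ℂ)).re
        = ((cfold (fun a => cPoly (gzP2 c.Jb c.S c.lw2 c.m a c.J c.Q)) c.cls).eval (w : ℂ)).re := by
      rw [hprod]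
    rw [eval_cPoly, eval_cfold] at h
    simp only [Complex.add_re, Complex.ofReal_re, Complex.mul_re, Complex.I_re,
      Complex.I_im, Complex.ofReal_im, zero_mul, mul_zero, sub_zero, add_zero] at h
    exact h
  have hcf : cfold (fun a => (cPoly (gzP2 c.Jb c.S c.lw2 c.m a c.J c.Q)).eval (w : ℂ)) c.cls
      = cfold (fun a => (2 : ℂ) ^ c.S * (c.qden : ℂ) * 2 ^ a * prP c.m c.J c.Jb c.Q c.qden a w) c.cls :=
    cfold_congr c.cls fun ap hap => eval_cPoly_gzP2 _ _ _ _ _ _ _ _ hp.toT.qden_pos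
      (fun j s hj hs => hp.midb_dy _ (c.cosOrd_le_maxOrd hap hj hs)) w
  have hc : ((2 : ℂ) ^ c.S * (c.qden : ℂ)) ^ psumL c.cls * (2 : ℂ) ^ asumL c.cls
      = ((((2 : ℝ) ^ c.S * c.qden) ^ D * 2 ^ c.asum : ℝ) : ℂ) := by
    rw [← c.psum_eq_psumL, hp.psum_eq, ← c.asum_eq_asumL]; push_cast; ring
  rw [hev, hcf, cfold_mul_two_pow ((2 : ℂ) ^ c.S * (c.qden : ℂ)) (fun a => prP c.m c.J c.Jb c.Q c.qden a w) c.cls,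
    hc, Complex.re_ofReal_mul]

end PrCert

/-- Termwise norm bound of `W_a - P_a` from order-wise bracket errors. [cite: FitznerVanDerHofstad2016NoBLE, §5.1.1 (5.4)–(5.5) pp. 1089–1090] -/
theorem norm_prW_sub_prP_le (m J Jb : ℕ) (Q : ℕ → ℤ) (qden a : ℕ) (u w : ℝ) (e : ℕ → ℝ)
    (he : ∀ b, b ≤ J * m + a →
      |√(2 * π * u) * srwHeatKernel u (b : ℤ) - (toPolyQ (midList b Jb)).eval w| ≤ e b) :
    ‖prW m J Q qden a u - prP m J Jb Q qden a w‖
      ≤ ∑ j ∈ range (J + 1), ∑ s ∈ range (a + 1),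
          (epsN j : ℝ) * (|(Q j : ℝ)| / qden) * (((a.choose s : ℕ) : ℝ) / 2 ^ a) * e (cosOrd m a j s) := by
  rw [prW, prP, ← sum_sub_distrib]
  refine (norm_sum_le _ _).trans (sum_le_sum fun j hj => ?_)
  rw [Finset.mem_range] at hj
  rw [← sum_sub_distrib]
  refine (norm_sum_le _ _).trans (sum_le_sum fun s hs => ?_)
  rw [Finset.mem_range] at hs
  have hc0 : 0 ≤ ((a.choose s : ℕ) : ℝ) / 2 ^ a := by positivity
  rw [← mul_sub, ← Complex.ofReal_sub, norm_mul, norm_mul, norm_mul, norm_mul, Complex.norm_natCast,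
    norm_pow, Complex.norm_I, one_pow, mul_one, Complex.norm_real, Complex.norm_real,
    Real.norm_of_nonneg hc0, Real.norm_eq_abs, norm_div, Complex.norm_intCast, Complex.norm_natCast]
  gcongr
  have hjm : j * m ≤ J * m := Nat.mul_le_mul_right m (by omega)
  exact he _ (by have := cosOrd_le m a j s (by omega); omega)

/-- Termwise norm bound of `P_a` from order-wise bounds. [cite: FitznerVanDerHofstad2016NoBLE, §5.1.1 (5.4)–(5.5) pp. 1089–1090] -/
theorem norm_prP_le (m J Jb : ℕ) (Q : ℕ → ℤ) (qden a : ℕ) (w : ℝ) (b : ℕ → ℝ)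
    (hb : ∀ o, o ≤ J * m + a → |(toPolyQ (midList o Jb)).eval w| ≤ b o) :
    ‖prP m J Jb Q qden a w‖
      ≤ ∑ j ∈ range (J + 1), ∑ s ∈ range (a + 1),
          (epsN j : ℝ) * (|(Q j : ℝ)| / qden) * (((a.choose s : ℕ) : ℝ) / 2 ^ a) * b (cosOrd m a j s) := by
  rw [prP]
  refine (norm_sum_le _ _).trans (sum_le_sum fun j hj => ?_)
  rw [Finset.mem_range] at hj
  refine (norm_sum_le _ _).trans (sum_le_sum fun s hs => ?_)
  rw [Finset.mem_range] at hs
  have hc0 : 0 ≤ ((a.choose s : ℕ) : ℝ) / 2 ^ a := by positivity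
  rw [norm_mul, norm_mul, norm_mul, norm_mul, Complex.norm_natCast, norm_pow, Complex.norm_I, one_pow,
    mul_one, Complex.norm_real, Complex.norm_real, Real.norm_of_nonneg hc0, Real.norm_eq_abs, norm_div,
    Complex.norm_intCast, Complex.norm_natCast]
  gcongr
  have hjm : j * m ≤ J * m := Nat.mul_le_mul_right m (by omega)
  exact hb _ (by have := cosOrd_le m a j s (by omega); omega)

end TailSem2

/-! ### Part 6c-ii — the `[T,∞)` block of the product kernel in ball form -/

section TailBlock2

open Polynomial
open Literature.Probability.LatticeModels (bracketCoeffQ complSum complSum_nonneg invSqrtCoeff_eq_cast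
  srwHeatKernel_bracket_eps_coeffQ)

namespace PrCert

variable (c : PrCert) (D : ℕ)

/-- The bracket constant of `srwHeatKernel_bracket_eps_coeffQ` (order `Jb`, `T₀ = t²`) is at most `eps a`
for every order `a ≤ maxOrd` (product kernel). [cite: FitznerVanDerHofstad2016NoBLE, §5.1.1 (5.4)–(5.5) pp. 1089–1090] -/
theorem bracketConst_leP (hp : c.ParamsP D) {a : ℕ} (ha : a ≤ c.maxOrd) :
    invSqrtCoeff (c.Jb + 1) / (1 - ((c.s0 : ℚ) : ℝ) ^ 2) * ((2 * c.Jb + 1)‼ : ℝ) / 4 ^ (c.Jb + 1)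
      + √(2 * π) * Real.exp (-(2 * ((c.t : ℝ) ^ 2) * ((c.s0 : ℚ) : ℝ) ^ 2))
        * ((c.t : ℝ) ^ 2) ^ ((c.Jb : ℝ) + 3 / 2)
        * (1 + 2 / π * ∑ i ∈ range (a + c.Jb + 1), |((bracketCoeffQ a c.Jb i : ℚ) : ℝ)|
            * (1 / (2 * ((c.s0 : ℚ) : ℝ)) * complSum i (((c.s0 : ℚ) : ℝ) ^ 2) (2 * (c.t : ℝ) ^ 2)))
      ≤ ((c.eps a : ℚ) : ℝ) := by
  have heps := hp.epsb_ge a ha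
  have heps' : ((epsBoundQ a c.Jb c.s0 c.t c.sHi c.nexp : ℚ) : ℝ) ≤ ((c.eps a : ℚ) : ℝ) := by
    exact_mod_cast heps
  refine le_trans ?_ heps'
  rw [epsBoundQ]
  push_cast
  simp only [cast_complSumQ, cast_expPartialQ, ← invSqrtCoeff_eq_cast]
  push_cast
  have ht : (0 : ℝ) < (c.t : ℝ) := by exact_mod_cast hp.toT.t_pos
  have hs0 : (0 : ℝ) < ((c.s0 : ℚ) : ℝ) := by exact_mod_cast hp.toT.s0_pos
  rw [sq_rpow_J (c.t : ℝ) ht c.Jb]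
  refine add_le_add le_rfl ?_
  have hSum0 : 0 ≤ ∑ i ∈ range (a + c.Jb + 1), |((bracketCoeffQ a c.Jb i : ℚ) : ℝ)|
      * (1 / (2 * ((c.s0 : ℚ) : ℝ)) * complSum i (((c.s0 : ℚ) : ℝ) ^ 2) (2 * (c.t : ℝ) ^ 2)) := by
    apply sum_nonneg
    intro i _
    apply mul_nonneg (abs_nonneg _)
    apply mul_nonneg (by positivity)
    exact complSum_nonneg i (by positivity) (by positivity)
  have hsHi : √(2 * π) ≤ ((c.sHi : ℚ) : ℝ) := by
    have h1 : 2 * π ≤ ((c.sHi : ℚ) : ℝ) ^ 2 := by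
      have := hp.toT.sHi_sq
      have h2 : ((2 * piHi : ℚ) : ℝ) ≤ ((c.sHi ^ 2 : ℚ) : ℝ) := by exact_mod_cast this
      push_cast at h2
      linarith [(show Real.pi < ((piHi : ℚ) : ℝ) from Literature.NumberTheory.LFunctions.lt_piHi20)]
    have hpos : (0 : ℝ) ≤ ((c.sHi : ℚ) : ℝ) := by exact_mod_cast hp.toT.sHi_pos.le
    calc √(2 * π) ≤ √(((c.sHi : ℚ) : ℝ) ^ 2) := Real.sqrt_le_sqrt h1
      _ = ((c.sHi : ℚ) : ℝ) := Real.sqrt_sq hpos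
  have hy : (0 : ℝ) ≤ 2 * (c.t : ℝ) ^ 2 * ((c.s0 : ℚ) : ℝ) ^ 2 := by positivity
  have hE0 : 0 < expPartial (2 * (c.t : ℝ) ^ 2 * ((c.s0 : ℚ) : ℝ) ^ 2) c.nexp := by
    obtain ⟨k, hk⟩ : ∃ k, c.nexp = k + 1 := ⟨c.nexp - 1, by have := hp.toT.nexp_pos; omega⟩
    rw [hk, expPartial, Finset.sum_range_succ']
    simp only [pow_zero, Nat.factorial_zero, Nat.cast_one, div_one]
    have : 0 ≤ ∑ i ∈ range k, (2 * (c.t : ℝ) ^ 2 * ((c.s0 : ℚ) : ℝ) ^ 2) ^ (i + 1) / ((i + 1)! : ℝ) :=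
      sum_nonneg fun i _ => by positivity
    linarith
  have hexp : Real.exp (-(2 * (c.t : ℝ) ^ 2 * ((c.s0 : ℚ) : ℝ) ^ 2))
      ≤ 1 / expPartial (2 * (c.t : ℝ) ^ 2 * ((c.s0 : ℚ) : ℝ) ^ 2) c.nexp := by
    rw [Real.exp_neg, ← one_div]
    exact one_div_le_one_div_of_le hE0 (expPartial_le_exp hy _)
  have hpi : 2 / π ≤ 2 / ((piLo : ℚ) : ℝ) :=
    div_le_div_of_nonneg_left (by norm_num) piLo_pos
      (show ((piLo : ℚ) : ℝ) < Real.pi from Literature.NumberTheory.LFunctions.piLo20_lt).le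
  have hA : √(2 * π) * Real.exp (-(2 * (c.t : ℝ) ^ 2 * ((c.s0 : ℚ) : ℝ) ^ 2))
      ≤ ((c.sHi : ℚ) : ℝ) * (1 / expPartial (2 * (c.t : ℝ) ^ 2 * ((c.s0 : ℚ) : ℝ) ^ 2) c.nexp) :=
    mul_le_mul hsHi hexp (Real.exp_nonneg _) (by exact_mod_cast hp.toT.sHi_pos.le)
  have hB : 1 + 2 / π * ∑ i ∈ range (a + c.Jb + 1), |((bracketCoeffQ a c.Jb i : ℚ) : ℝ)|
        * (1 / (2 * ((c.s0 : ℚ) : ℝ)) * complSum i (((c.s0 : ℚ) : ℝ) ^ 2) (2 * (c.t : ℝ) ^ 2))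
      ≤ 1 + 2 / ((piLo : ℚ) : ℝ) * ∑ i ∈ range (a + c.Jb + 1), |((bracketCoeffQ a c.Jb i : ℚ) : ℝ)|
        * (1 / (2 * ((c.s0 : ℚ) : ℝ)) * complSum i (((c.s0 : ℚ) : ℝ) ^ 2) (2 * (c.t : ℝ) ^ 2)) :=
    add_le_add le_rfl (mul_le_mul_of_nonneg_right hpi hSum0)
  have hP0 : (0 : ℝ) ≤ ((c.t : ℝ) ^ 2) ^ (c.Jb + 1) * (c.t : ℝ) := by positivity
  have hB0 : (0 : ℝ) ≤ 1 + 2 / π * ∑ i ∈ range (a + c.Jb + 1), |((bracketCoeffQ a c.Jb i : ℚ) : ℝ)|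
        * (1 / (2 * ((c.s0 : ℚ) : ℝ)) * complSum i (((c.s0 : ℚ) : ℝ) ^ 2) (2 * (c.t : ℝ) ^ 2)) := by
    positivity
  calc √(2 * π) * Real.exp (-(2 * (c.t : ℝ) ^ 2 * ((c.s0 : ℚ) : ℝ) ^ 2))
        * (((c.t : ℝ) ^ 2) ^ (c.Jb + 1) * (c.t : ℝ)) * _
      ≤ ((c.sHi : ℚ) : ℝ) * (1 / expPartial (2 * (c.t : ℝ) ^ 2 * ((c.s0 : ℚ) : ℝ) ^ 2) c.nexp)
        * (((c.t : ℝ) ^ 2) ^ (c.Jb + 1) * (c.t : ℝ)) * _ := by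
        apply mul_le_mul (mul_le_mul_of_nonneg_right hA hP0) hB hB0
        exact mul_nonneg (mul_nonneg (by exact_mod_cast hp.toT.sHi_pos.le) (by positivity)) hP0
    _ = _ := by ring

/-- **The midpoint bracket** for every order `a ≤ maxOrd` (product kernel), `u ≥ t²`:
`|√(2πu) q_u(a) − Mid_a(1/u)| ≤ eps_a (1/u)^{Jb+1}`. [cite: FitznerVanDerHofstad2016NoBLE, §5.1.1 (5.4)–(5.5) pp. 1089–1090] -/
theorem mid_bracketP (hp : c.ParamsP D) {a : ℕ} (ha : a ≤ c.maxOrd) {u : ℝ} (hu : (c.t : ℝ) ^ 2 ≤ u) :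
    |√(2 * π * u) * srwHeatKernel u (a : ℤ) - (toPolyQ (midList a c.Jb)).eval (1 / u)|
      ≤ ((c.eps a : ℚ) : ℝ) * (1 / u) ^ (c.Jb + 1) := by
  have ht : (0 : ℝ) < (c.t : ℝ) := by exact_mod_cast hp.toT.t_pos
  have hu0 : 0 < u := lt_of_lt_of_le (by positivity) hu
  have hs0 : (0 : ℝ) < ((c.s0 : ℚ) : ℝ) := by exact_mod_cast hp.toT.s0_pos
  have hs1 : ((c.s0 : ℚ) : ℝ) < 1 := by exact_mod_cast hp.toT.s0_lt
  have hTc : ((c.Jb : ℝ) + 3 / 2) / (2 * ((c.s0 : ℚ) : ℝ) ^ 2) ≤ (c.t : ℝ) ^ 2 := by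
    have h' := (Rat.cast_le (K := ℝ)).mpr hp.toT.hT
    push_cast at h'
    exact h'
  have hb := srwHeatKernel_bracket_eps_coeffQ (u := u) hs0 hs1 (a : ℤ) c.Jb hTc hu
  simp only [Int.natAbs_natCast] at hb
  have hC := c.bracketConst_leP D hp ha
  have hmain : ∑ i ∈ range (a + c.Jb + 1),
        ((bracketCoeffQ a c.Jb i : ℚ) : ℝ) * ((2 * i - 1)‼ : ℝ) / (4 * u) ^ i
      = ∑ i ∈ range (a + c.Jb + 1), ((mcoef a c.Jb i : ℚ) : ℝ) * (1 / u) ^ i := by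
    refine sum_congr rfl fun i _ => ?_
    rw [mcoef]; push_cast
    rw [mul_pow, one_div_pow]
    field_simp
  rw [hmain] at hb
  have hw : (u ^ (c.Jb + 1))⁻¹ = (1 / u) ^ (c.Jb + 1) := by rw [one_div_pow, one_div]
  rw [hw] at hb
  have hw0 : (0 : ℝ) ≤ (1 / u) ^ (c.Jb + 1) := by positivity
  rw [eval_toPolyQ_midList]
  exact hb.trans (mul_le_mul_of_nonneg_right hC hw0)

/-- `wepsSum2 a` cast to `ℝ` as a double sum. [cite: FitznerVanDerHofstad2016NoBLE, §5.1.1 (5.4)–(5.5) pp. 1089–1090] -/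
theorem cast_wepsSum2 (a : ℕ) : ((c.wepsSum2 a : ℚ) : ℝ)
    = ∑ j ∈ range (c.J + 1), ∑ s ∈ range (a + 1),
        (epsN j : ℝ) * ((a.choose s : ℕ) : ℝ) * |(c.Q j : ℝ)| * ((c.eps (cosOrd c.m a j s) : ℚ) : ℝ) := by
  have e := sum_flat (fun j s => (cosW a c.Q j s : ℝ) * ((c.eps (cosOrd c.m a j s) : ℚ) : ℝ)) a (c.J + 1)
  beta_reduce at e
  have key : ∀ (F : ℕ → ℚ) (n : ℕ), ((List.range n).map F).sum = ∑ i ∈ range n, F i := by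
    intro F n
    induction n with
    | zero => simp
    | succ n ih => rw [List.range_succ, List.map_append, List.sum_append, ih, sum_range_succ]; simp
  unfold PrCert.wepsSum2
  rw [key]
  push_cast
  rw [e]
  refine sum_congr rfl fun j _ => sum_congr rfl fun s _ => ?_
  rw [cosW_eq]
  push_cast
  rw [Nat.cast_natAbs, Int.cast_abs]

/-- **The `E`-bound of a class**: `‖W_a(u) − P_a(1/u)‖ ≤ ρ (1/u)^{Jb+1}` for `u ≥ t²`.
[cite: FitznerVanDerHofstad2016NoBLE, §5.1.1 (5.4)–(5.5) pp. 1089–1090] -/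
theorem E_boundP (hp : c.ParamsP D) {ap : ℕ × ℕ} (hap : ap ∈ c.cls) {u : ℝ} (hu : (c.t : ℝ) ^ 2 ≤ u) :
    ‖prW c.m c.J c.Q c.qden ap.1 u - prP c.m c.J c.Jb c.Q c.qden ap.1 (1 / u)‖
      ≤ ((c.rho : ℚ) : ℝ) * (1 / u) ^ (c.Jb + 1) := by
  have ht : (0 : ℝ) < (c.t : ℝ) := by exact_mod_cast hp.toT.t_pos
  have hu0 : 0 < u := lt_of_lt_of_le (by positivity) hu
  have hq0 : (0 : ℝ) < c.qden := by exact_mod_cast hp.toT.qden_pos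
  have hw0 : (0 : ℝ) ≤ (1 / u) ^ (c.Jb + 1) := by positivity
  have h1 := norm_prW_sub_prP_le c.m c.J c.Jb c.Q c.qden ap.1 u (1 / u)
    (fun b => ((c.eps b : ℚ) : ℝ) * (1 / u) ^ (c.Jb + 1))
    (fun b hb => c.mid_bracketP D hp (by have := c.le_amax hap; unfold PrCert.maxOrd; omega) hu)
  have h2 : ∑ j ∈ range (c.J + 1), ∑ s ∈ range (ap.1 + 1), (epsN j : ℝ) * (|(c.Q j : ℝ)| / c.qden)
        * (((ap.1.choose s : ℕ) : ℝ) / 2 ^ ap.1)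
        * (((c.eps (cosOrd c.m ap.1 j s) : ℚ) : ℝ) * (1 / u) ^ (c.Jb + 1))
      = ((c.wepsSum2 ap.1 : ℚ) : ℝ) / (c.qden * 2 ^ ap.1) * (1 / u) ^ (c.Jb + 1) := by
    rw [c.cast_wepsSum2, sum_div, sum_mul]
    refine sum_congr rfl fun j _ => ?_
    rw [sum_div, sum_mul]
    refine sum_congr rfl fun s _ => ?_
    ring
  rw [h2] at h1
  refine h1.trans (mul_le_mul_of_nonneg_right ?_ hw0)
  rw [div_le_iff₀ (by positivity)]
  have h3 : ((c.wepsSum2 ap.1 : ℚ) : ℝ) ≤ ((c.rho * c.qden * (2 : ℚ) ^ ap.1 : ℚ) : ℝ) := by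
    exact_mod_cast hp.weps2_le ap hap
  push_cast at h3
  calc ((c.wepsSum2 ap.1 : ℚ) : ℝ) ≤ ((c.rho : ℚ) : ℝ) * (c.qden : ℝ) * 2 ^ ap.1 := h3
    _ = ((c.rho : ℚ) : ℝ) * ((c.qden : ℝ) * 2 ^ ap.1) := by ring

/-- **The `P`-bound of a class**: `‖P_a(1/u)‖ ≤ α U_0(1/u) + ρ (1/u)^{Jb+1}` for `u ≥ t²`, and `0 ≤ U_0(1/u)`.
[cite: FitznerVanDerHofstad2016NoBLE, §5.1.1 (5.4)–(5.5) pp. 1089–1090] -/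
theorem P_boundP (hp : c.ParamsP D) {ap : ℕ × ℕ} (hap : ap ∈ c.cls) {u : ℝ} (hu : (c.t : ℝ) ^ 2 ≤ u) :
    ‖prP c.m c.J c.Jb c.Q c.qden ap.1 (1 / u)‖
        ≤ ((c.alpha : ℚ) : ℝ) * c.U0 (1 / u) + ((c.rho : ℚ) : ℝ) * (1 / u) ^ (c.Jb + 1) ∧
      0 ≤ c.U0 (1 / u) := by
  have ht : (0 : ℝ) < (c.t : ℝ) := by exact_mod_cast hp.toT.t_pos
  have hu0 : 0 < u := lt_of_lt_of_le (by positivity) hu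
  have hq0 : (0 : ℝ) < c.qden := by exact_mod_cast hp.toT.qden_pos
  have hw0 : (0 : ℝ) ≤ (1 / u) ^ (c.Jb + 1) := by positivity
  have hU : √(2 * π * u) * srwHeatKernel u 0 ≤ c.U0 (1 / u) := c.toTwCert.upper0T D hp.toT hu
  have hk0 : 0 ≤ √(2 * π * u) * srwHeatKernel u 0 :=
    mul_nonneg (Real.sqrt_nonneg _) (srwHeatKernel_nonneg hu0.le _)
  have hU0 : 0 ≤ c.U0 (1 / u) := hk0.trans hU
  refine ⟨?_, hU0⟩
  have hb : ∀ o, o ≤ c.J * c.m + ap.1 → |(toPolyQ (midList o c.Jb)).eval (1 / u)|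
      ≤ c.U0 (1 / u) + ((c.eps o : ℚ) : ℝ) * (1 / u) ^ (c.Jb + 1) := by
    intro o ho
    have hm := c.mid_bracketP D hp (a := o) (by have := c.le_amax hap; unfold PrCert.maxOrd; omega) hu
    have hko0 : 0 ≤ √(2 * π * u) * srwHeatKernel u (o : ℤ) :=
      mul_nonneg (Real.sqrt_nonneg _) (srwHeatKernel_nonneg hu0.le _)
    have hko : √(2 * π * u) * srwHeatKernel u (o : ℤ) ≤ √(2 * π * u) * srwHeatKernel u 0 :=
      mul_le_mul_of_nonneg_left (srwHeatKernel_le_zero_index hu0.le _) (Real.sqrt_nonneg _)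
    rw [abs_le]
    obtain ⟨hm1, hm2⟩ := abs_sub_le_iff.1 hm
    constructor <;> nlinarith
  have h1 := norm_prP_le c.m c.J c.Jb c.Q c.qden ap.1 (1 / u) _ hb
  have h2 : ∑ j ∈ range (c.J + 1), ∑ s ∈ range (ap.1 + 1), (epsN j : ℝ) * (|(c.Q j : ℝ)| / c.qden)
        * (((ap.1.choose s : ℕ) : ℝ) / 2 ^ ap.1)
        * (c.U0 (1 / u) + ((c.eps (cosOrd c.m ap.1 j s) : ℚ) : ℝ) * (1 / u) ^ (c.Jb + 1))
      = (c.wabsSum : ℝ) / c.qden * c.U0 (1 / u)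
        + ((c.wepsSum2 ap.1 : ℚ) : ℝ) / (c.qden * 2 ^ ap.1) * (1 / u) ^ (c.Jb + 1) := by
    rw [c.cast_wepsSum2, c.toTwCert.cast_wabsSum, sum_div, sum_div, sum_mul, sum_mul, ← sum_add_distrib]
    refine sum_congr rfl fun j _ => ?_
    rw [sum_div, sum_mul]
    have hC := sum_choose_div_two_pow ap.1
    calc ∑ s ∈ range (ap.1 + 1), (epsN j : ℝ) * (|(c.Q j : ℝ)| / c.qden)
            * (((ap.1.choose s : ℕ) : ℝ) / 2 ^ ap.1)
            * (c.U0 (1 / u) + ((c.eps (cosOrd c.m ap.1 j s) : ℚ) : ℝ) * (1 / u) ^ (c.Jb + 1))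
        = (epsN j : ℝ) * (|(c.Q j : ℝ)| / c.qden) * c.U0 (1 / u)
              * ∑ s ∈ range (ap.1 + 1), ((ap.1.choose s : ℕ) : ℝ) / 2 ^ ap.1
            + ∑ s ∈ range (ap.1 + 1), (epsN j : ℝ) * ((ap.1.choose s : ℕ) : ℝ) * |(c.Q j : ℝ)|
              * ((c.eps (cosOrd c.m ap.1 j s) : ℚ) : ℝ) / (c.qden * 2 ^ ap.1) * (1 / u) ^ (c.Jb + 1) := by
          rw [mul_sum, ← sum_add_distrib]
          refine sum_congr rfl fun s _ => ?_
          ring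
      _ = _ := by rw [hC, mul_one]; ring
  rw [h2] at h1
  refine h1.trans (add_le_add (mul_le_mul_of_nonneg_right ?_ hU0) (mul_le_mul_of_nonneg_right ?_ hw0))
  · rw [div_le_iff₀ hq0]
    exact_mod_cast hp.toT.wabs_le
  · rw [div_le_iff₀ (by positivity)]
    have h3 : ((c.wepsSum2 ap.1 : ℚ) : ℝ) ≤ ((c.rho * c.qden * (2 : ℚ) ^ ap.1 : ℚ) : ℝ) := by
      exact_mod_cast hp.weps2_le ap hap
    push_cast at h3
    calc ((c.wepsSum2 ap.1 : ℚ) : ℝ) ≤ ((c.rho : ℚ) : ℝ) * (c.qden : ℝ) * 2 ^ ap.1 := h3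
      _ = ((c.rho : ℚ) : ℝ) * ((c.qden : ℝ) * 2 ^ ap.1) := by ring

/-- **Pointwise control of `Re Π W_a^{p_a}` on `[t²,∞)`**:
`|Re Π W_a(u)^{p_a} − Re Π P_a(1/u)^{p_a}| ≤ G₂(1/u)^D − G₁(1/u)^D`. [cite: FitznerVanDerHofstad2016NoBLE, §5.1.1 (5.4)–(5.5) pp. 1089–1090] -/
theorem re_prod_perturbP (hp : c.ParamsP D) {u : ℝ} (hu : (c.t : ℝ) ^ 2 ≤ u) :
    |(cfold (fun a => prW c.m c.J c.Q c.qden a u) c.cls).re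
        - (cfold (fun a => prP c.m c.J c.Jb c.Q c.qden a (1 / u)) c.cls).re|
      ≤ (((c.alpha : ℚ) : ℝ) * c.U0 (1 / u) + 2 * (((c.rho : ℚ) : ℝ) * (1 / u) ^ (c.Jb + 1))) ^ D
        - (((c.alpha : ℚ) : ℝ) * c.U0 (1 / u) + ((c.rho : ℚ) : ℝ) * (1 / u) ^ (c.Jb + 1)) ^ D := by
  have ht : (0 : ℝ) < (c.t : ℝ) := by exact_mod_cast hp.toT.t_pos
  have hu0 : 0 < u := lt_of_lt_of_le (by positivity) hu
  have hρ0 : 0 ≤ ((c.rho : ℚ) : ℝ) * (1 / u) ^ (c.Jb + 1) :=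
    mul_nonneg (by exact_mod_cast hp.toT.rho_nonneg) (by positivity)
  have hpD : psumL c.cls = D := by rw [← c.psum_eq_psumL]; exact hp.psum_eq
  have hA0 : 0 ≤ ((c.alpha : ℚ) : ℝ) * c.U0 (1 / u) + ((c.rho : ℚ) : ℝ) * (1 / u) ^ (c.Jb + 1) := by
    obtain ⟨ap, hap⟩ := List.exists_mem_of_ne_nil c.cls hp.ne
    exact (norm_nonneg _).trans (c.P_boundP D hp hap hu).1
  have h := norm_cfold_sub_cfold_le (fun a => prP c.m c.J c.Jb c.Q c.qden a (1 / u))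
    (fun a => prW c.m c.J c.Q c.qden a u) hA0 hρ0 c.cls
    (fun ap hap => (c.P_boundP D hp hap hu).1) (fun ap hap => c.E_boundP D hp hap hu)
  rw [hpD] at h
  rw [← Complex.sub_re]
  refine (Complex.abs_re_le_norm _).trans (h.trans_eq ?_)
  ring

/-- **The `[T,∞)` block of the product kernel in ball form**:
`tailLo_n ≤ ∫_{t²}^∞ u^{n'} Re Ψ(u) du ≤ tailHi_n` (`n = n'+1 ≤ 4`), from the parameter facts, `tailCheckIM`
and `tailCheckIB`. [cite: FitznerVanDerHofstad2016NoBLE, §5.1.1 (5.4)–(5.5) pp. 1089–1090] -/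
theorem ioi_blockP (hp : c.ParamsP D) (him : c.tailCheckIM D = true) (hib : c.tailCheckIB D = true)
    (n' : ℕ) (hn : n' ≤ 3) : c.IoiBlockP D n' := by
  rw [PrCert.IoiBlockP]
  have ht : (0 : ℝ) < (c.t : ℝ) := by exact_mod_cast hp.toT.t_pos
  have hT0 : (0 : ℝ) < (c.t : ℝ) ^ 2 := by positivity
  have hd : 2 * n' + 3 ≤ D := by have := hp.toT.hD; omega
  have hq0 : (0 : ℝ) < c.qden := by exact_mod_cast hp.toT.qden_pos
  have hpD : psumL c.cls = D := by rw [← c.psum_eq_psumL]; exact hp.psum_eq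
  obtain ⟨him1, him2⟩ := c.tailCheckIM_spec D him (n' + 1) (by omega) (by omega)
  have hib1 := c.tailCheckIB_spec D hib (n' + 1) (by omega) (by omega)
  set κ : ℝ := ((√(2 * π)) ^ D)⁻¹ with hκ
  have hκ0 : 0 < κ := by positivity
  set g : ℝ → ℝ := fun u => u ^ n' * (prPsiP c.m c.J c.Q c.qden c.cls u).re with hg
  set gg : List ℕ × List ℕ := (powN c.lg c.g2 D, powN c.lg c.g1 D) with hgg
  set fM : ℝ → ℝ := fun u => κ * (u ^ n' / (√u) ^ D * (pnPoly c.powRe2).eval (1 / u))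
    / (((2 : ℝ) ^ c.S * c.qden) ^ D * 2 ^ c.asum) with hfM
  set fB : ℝ → ℝ := fun u => κ * (u ^ n' / (√u) ^ D * (pnPoly gg).eval (1 / u))
    / (((2 : ℝ) ^ (2 * c.S)) ^ D) with hfB
  have hlenP : c.powRe2.1.length = c.powRe2.2.length := c.powRe2_len D hp
  have hlenG : gg.1.length = gg.2.length := by
    simp only [hgg]; rw [length_powN, length_powN]
  obtain ⟨hintM, hIMeq⟩ := integral_tailPoly hp.toT.t_pos hd c.powRe2 hlenP
  obtain ⟨hintG, hIGeq⟩ := integral_tailPoly hp.toT.t_pos hd gg hlenG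
  have hfM_int : IntegrableOn fM (Ioi ((c.t : ℝ) ^ 2)) := by
    rw [hfM]; exact (hintM.const_mul κ).div_const _
  have hfB_int : IntegrableOn fB (Ioi ((c.t : ℝ) ^ 2)) := by
    rw [hfB]; exact (hintG.const_mul κ).div_const _
  set IMr : ℝ := ((c.IM2 D c.powRe2 (n' + 1) : ℚ) : ℝ) with hIMr
  set IBr : ℝ := ((c.toTwCert.IB D gg (n' + 1) : ℚ) : ℝ) with hIBr
  have hIM : ∫ u in Ioi ((c.t : ℝ) ^ 2), fM u = κ * IMr := by
    rw [hfM, integral_div, integral_const_mul, hIMeq, hIMr, PrCert.IM2, PrCert.scaleP2, PrCert.twoA]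
    push_cast
    ring
  have hIB : ∫ u in Ioi ((c.t : ℝ) ^ 2), fB u = κ * IBr := by
    rw [hfB, integral_div, integral_const_mul, hIGeq, hIBr, TwCert.IB, TwCert.scaleG]
    push_cast
    ring
  -- pointwise comparison on `(t², ∞)`
  have hle : ∀ u ∈ Ioi ((c.t : ℝ) ^ 2), fM u - fB u ≤ g u ∧ g u ≤ fM u + fB u ∧ 0 ≤ fB u := by
    intro u hu
    rw [Set.mem_Ioi] at hu
    have hu0 : 0 < u := hT0.trans hu
    have hfac : 0 ≤ κ * (u ^ n' / (√u) ^ D) := by positivity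
    have hpert := c.re_prod_perturbP D hp hu.le
    have hgu : g u = κ * (u ^ n' / (√u) ^ D) * (cfold (fun a => prW c.m c.J c.Q c.qden a u) c.cls).re := by
      simp only [hg]
      exact integrand_eqP c.m c.J c.Q c.qden c.cls hpD n' hu0
    have hfMu : fM u = κ * (u ^ n' / (√u) ^ D)
        * (cfold (fun a => prP c.m c.J c.Jb c.Q c.qden a (1 / u)) c.cls).re := by
      simp only [hfM]
      rw [c.powRe2_eval D hp (1 / u)]
      have hM0 : ((2 : ℝ) ^ c.S * c.qden) ^ D * 2 ^ c.asum ≠ 0 := by positivity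
      field_simp
    have hfBu : fB u = κ * (u ^ n' / (√u) ^ D)
        * ((((c.alpha : ℚ) : ℝ) * c.U0 (1 / u) + 2 * (((c.rho : ℚ) : ℝ) * (1 / u) ^ (c.Jb + 1))) ^ D
          - (((c.alpha : ℚ) : ℝ) * c.U0 (1 / u) + ((c.rho : ℚ) : ℝ) * (1 / u) ^ (c.Jb + 1)) ^ D) := by
      simp only [hfB]
      rw [c.toTwCert.gg_eval D hp.toT (1 / u)]
      have h2 : ((2 : ℝ) ^ (2 * c.S)) ^ D ≠ 0 := by positivity
      field_simp
    rw [hgu, hfMu, hfBu, ← mul_sub, ← mul_add]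
    obtain ⟨h1, h2⟩ := abs_sub_le_iff.1 hpert
    exact ⟨mul_le_mul_of_nonneg_left (by linarith) hfac, mul_le_mul_of_nonneg_left (by linarith) hfac,
      mul_nonneg hfac ((abs_nonneg _).trans hpert)⟩
  have hg_int : IntegrableOn g (Ioi ((c.t : ℝ) ^ 2)) :=
    (integrableOn_ublockP c.m c.J c.Q c.qden hp.toT.qden_pos hp.toT.Q_le c.cls hpD n' hd).mono_set
      (Ioi_subset_Ioi hT0.le)
  have hlowI : κ * IMr - κ * IBr ≤ ∫ u in Ioi ((c.t : ℝ) ^ 2), g u := by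
    rw [← hIM, ← hIB, ← integral_sub hfM_int hfB_int]
    exact setIntegral_mono_on (hfM_int.sub hfB_int) hg_int measurableSet_Ioi fun u hu => (hle u hu).1
  have hupI : ∫ u in Ioi ((c.t : ℝ) ^ 2), g u ≤ κ * IMr + κ * IBr := by
    rw [← hIM, ← hIB, ← integral_add hfM_int hfB_int]
    exact setIntegral_mono_on hg_int (hfM_int.add hfB_int) measurableSet_Ioi fun u hu => (hle u hu).2.1
  have hIB0 : 0 ≤ IBr := by
    have h0 : 0 ≤ ∫ u in Ioi ((c.t : ℝ) ^ 2), fB u :=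
      setIntegral_nonneg measurableSet_Ioi fun u hu => (hle u hu).2.2
    rw [hIB] at h0
    by_contra hneg
    rw [not_le] at hneg
    have := mul_neg_of_pos_of_neg hκ0 hneg
    linarith
  -- the `(2π)^{-D/2}` brackets
  have hsHi : √(2 * π) ≤ ((c.sHi : ℚ) : ℝ) := by
    have h1 : 2 * π ≤ ((c.sHi : ℚ) : ℝ) ^ 2 := by
      have h2 : ((2 * piHi : ℚ) : ℝ) ≤ ((c.sHi ^ 2 : ℚ) : ℝ) := by exact_mod_cast hp.toT.sHi_sq
      push_cast at h2
      linarith [(show Real.pi < ((piHi : ℚ) : ℝ) from Literature.NumberTheory.LFunctions.lt_piHi20)]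
    calc √(2 * π) ≤ √(((c.sHi : ℚ) : ℝ) ^ 2) := Real.sqrt_le_sqrt h1
      _ = ((c.sHi : ℚ) : ℝ) := Real.sqrt_sq (by exact_mod_cast hp.toT.sHi_pos.le)
  have hsLo : ((c.sLo : ℚ) : ℝ) ≤ √(2 * π) := by
    have h1 : ((c.sLo : ℚ) : ℝ) ^ 2 ≤ 2 * π := by
      have h2 : ((c.sLo ^ 2 : ℚ) : ℝ) ≤ ((2 * piLo : ℚ) : ℝ) := by exact_mod_cast hp.toT.sLo_sq
      push_cast at h2
      linarith [(show ((piLo : ℚ) : ℝ) < Real.pi from Literature.NumberTheory.LFunctions.piLo20_lt)]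
    calc ((c.sLo : ℚ) : ℝ) = √(((c.sLo : ℚ) : ℝ) ^ 2) :=
          (Real.sqrt_sq (by exact_mod_cast hp.toT.sLo_pos.le)).symm
      _ ≤ √(2 * π) := Real.sqrt_le_sqrt h1
  have hsLo0 : (0 : ℝ) < ((c.sLo : ℚ) : ℝ) := by exact_mod_cast hp.toT.sLo_pos
  have hkLo : ((c.kLoT D : ℚ) : ℝ) ≤ κ := by
    rw [TwCert.kLoT, hκ]; push_cast
    rw [← one_div]
    apply one_div_le_one_div_of_le (by positivity)
    exact pow_le_pow_left₀ (by positivity) hsHi D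
  have hkHi : κ ≤ ((c.kHiT D : ℚ) : ℝ) := by
    rw [TwCert.kHiT, hκ]; push_cast
    rw [← one_div]
    apply one_div_le_one_div_of_le (by positivity)
    exact pow_le_pow_left₀ hsLo0.le hsLo D
  -- the sign-aware final brackets
  have hr : ((c.imLo (n' + 1) : ℚ) : ℝ) - ((c.ibHi (n' + 1) : ℚ) : ℝ) ≤ IMr - IBr := by
    have h1 : ((c.imLo (n' + 1) : ℚ) : ℝ) ≤ IMr := by rw [hIMr]; exact_mod_cast him1
    have h2 : IBr ≤ ((c.ibHi (n' + 1) : ℚ) : ℝ) := by rw [hIBr]; exact_mod_cast hib1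
    linarith
  have hs : IMr + IBr ≤ ((c.imHi (n' + 1) : ℚ) : ℝ) + ((c.ibHi (n' + 1) : ℚ) : ℝ) := by
    have h1 : IMr ≤ ((c.imHi (n' + 1) : ℚ) : ℝ) := by rw [hIMr]; exact_mod_cast him2
    have h2 : IBr ≤ ((c.ibHi (n' + 1) : ℚ) : ℝ) := by rw [hIBr]; exact_mod_cast hib1
    linarith
  constructor
  · have hk : ((c.tailLo D (n' + 1) : ℚ) : ℝ)
        ≤ κ * (((c.imLo (n' + 1) : ℚ) : ℝ) - ((c.ibHi (n' + 1) : ℚ) : ℝ)) := by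
      simp only [TwCert.tailLo]
      split_ifs with hsgn
      · have hr0 : (0 : ℝ) ≤ ((c.imLo (n' + 1) : ℚ) : ℝ) - ((c.ibHi (n' + 1) : ℚ) : ℝ) := by
          have : ((0 : ℚ) : ℝ) ≤ ((c.imLo (n' + 1) - c.ibHi (n' + 1) : ℚ) : ℝ) := by exact_mod_cast hsgn
          push_cast at this; linarith
        push_cast
        exact mul_le_mul_of_nonneg_right hkLo hr0
      · rw [not_le] at hsgn
        have hr0 : ((c.imLo (n' + 1) : ℚ) : ℝ) - ((c.ibHi (n' + 1) : ℚ) : ℝ) ≤ 0 := by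
          have : ((c.imLo (n' + 1) - c.ibHi (n' + 1) : ℚ) : ℝ) ≤ ((0 : ℚ) : ℝ) := by
            exact_mod_cast hsgn.le
          push_cast at this; linarith
        push_cast
        exact mul_le_mul_of_nonpos_right hkHi hr0
    calc ((c.tailLo D (n' + 1) : ℚ) : ℝ)
        ≤ κ * (((c.imLo (n' + 1) : ℚ) : ℝ) - ((c.ibHi (n' + 1) : ℚ) : ℝ)) := hk
      _ ≤ κ * (IMr - IBr) := mul_le_mul_of_nonneg_left hr hκ0.le
      _ = κ * IMr - κ * IBr := by ring
      _ ≤ _ := hlowI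
  · have hk : κ * (((c.imHi (n' + 1) : ℚ) : ℝ) + ((c.ibHi (n' + 1) : ℚ) : ℝ))
        ≤ ((c.tailHi D (n' + 1) : ℚ) : ℝ) := by
      simp only [TwCert.tailHi]
      split_ifs with hsgn
      · have hs0 : (0 : ℝ) ≤ ((c.imHi (n' + 1) : ℚ) : ℝ) + ((c.ibHi (n' + 1) : ℚ) : ℝ) := by
          have : ((0 : ℚ) : ℝ) ≤ ((c.imHi (n' + 1) + c.ibHi (n' + 1) : ℚ) : ℝ) := by exact_mod_cast hsgn
          push_cast at this; linarith
        push_cast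
        exact mul_le_mul_of_nonneg_right hkHi hs0
      · rw [not_le] at hsgn
        have hs0 : ((c.imHi (n' + 1) : ℚ) : ℝ) + ((c.ibHi (n' + 1) : ℚ) : ℝ) ≤ 0 := by
          have : ((c.imHi (n' + 1) + c.ibHi (n' + 1) : ℚ) : ℝ) ≤ ((0 : ℚ) : ℝ) := by
            exact_mod_cast hsgn.le
          push_cast at this; linarith
        push_cast
        exact mul_le_mul_of_nonpos_right hkLo hs0
    calc ∫ u in Ioi ((c.t : ℝ) ^ 2), g u ≤ κ * IMr + κ * IBr := hupI
      _ = κ * (IMr + IBr) := by ring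
      _ ≤ κ * (((c.imHi (n' + 1) : ℚ) : ℝ) + ((c.ibHi (n' + 1) : ℚ) : ℝ)) :=
          mul_le_mul_of_nonneg_left hs hκ0.le
      _ ≤ _ := hk

/-! ### The soundness theorem of the product kernel -/

/-- **Soundness of the product-row twisted SEEDCERT kernel**: if `checkP D` holds (parameter sanity, the
`[0,T]` Poisson-block brackets, the `[T,∞)` ball-form tail brackets and the final assembly), then for
`1 ≤ n ≤ 4` and every exponent vector `a : Fin D → ℕ` enumerating the classes (`List.ofFn a = unroll cls`)
the literal product-row object (the `u`-substituted seed integral whose `μ`-th factor is the binomially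
averaged Bessel row `Σ_j ε_j (Σ_s C(a_μ,s) 2^{-a_μ} I_{j m − (2s − a_μ)}(τ/D)) c_j` at the weights
`c_j = 2π i^j Q_j/qden`) lies in `[lo n, hi n]`.  Generic in the dimension `D ≥ 9`; number-free.
[cite: FitznerVanDerHofstad2016NoBLE, §5.1.1 (5.2)–(5.5) pp. 1089–1090] -/
theorem soundP (h : c.checkP D = true) (a : Fin D → ℕ) (ha : List.ofFn a = unroll c.cls)
    (n : ℕ) (hn1 : 1 ≤ n) (hn4 : n ≤ 4) :
    ((c.lo n : ℚ) : ℝ)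
        ≤ ((n - 1) ! : ℝ)⁻¹ * (∫ τ in Ioi (0:ℝ), τ ^ (n - 1) * (Real.exp (-τ) *
            (∏ μ, ∑ j ∈ Finset.range (c.J + 1), (if j = 0 then (1 : ℂ) else 2) *
              ((∑ s ∈ Finset.range (a μ + 1), (((a μ).choose s : ℂ) / 2 ^ (a μ)) *
                (besselI (j * (c.m : ℤ) - ((2 * (s : ℤ) - (a μ : ℕ) : ℤ))) (τ / D) : ℂ)) * c.cT j)).re))
          / (2 * π) ^ D ∧
      ((n - 1) ! : ℝ)⁻¹ * (∫ τ in Ioi (0:ℝ), τ ^ (n - 1) * (Real.exp (-τ) *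
            (∏ μ, ∑ j ∈ Finset.range (c.J + 1), (if j = 0 then (1 : ℂ) else 2) *
              ((∑ s ∈ Finset.range (a μ + 1), (((a μ).choose s : ℂ) / 2 ^ (a μ)) *
                (besselI (j * (c.m : ℤ) - ((2 * (s : ℤ) - (a μ : ℕ) : ℤ))) (τ / D) : ℂ)) * c.cT j)).re))
          / (2 * π) ^ D
        ≤ ((c.hi n : ℚ) : ℝ) := by
  obtain ⟨h1, -, -, h4, h5⟩ := c.checkP_spec D h
  exact c.soundP_of_ioiBlockP D h
    (fun n' hn => c.ioi_blockP D (c.paramsP_of_paramsOKP D h1) h4 h5 n' hn) a ha n hn1 hn4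

/-- `checkP` from its five conjuncts (lets an instance file split the `decide` into separately compiled
theorems). [cite: FitznerVanDerHofstad2016NoBLE, §5.1.1 (5.4)–(5.5) pp. 1089–1090] -/
theorem checkP_intro (h1 : c.paramsOKP D = true) (h2 : c.toTwCert.finalCheckT D = true)
    (h3 : c.poissonCheckP D = true) (h4 : c.tailCheckIM D = true) (h5 : c.tailCheckIB D = true) :
    c.checkP D = true := by
  simp only [PrCert.checkP, PrCert.tailCheckP, h1, h2, h3, h4, h5, Bool.and_self]

/-- **Soundness from the five separately decided conjuncts** (the form instance files use).
[cite: FitznerVanDerHofstad2016NoBLE, §5.1.1 (5.2)–(5.5) pp. 1089–1090] -/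
theorem soundP_of_parts (h1 : c.paramsOKP D = true) (h2 : c.toTwCert.finalCheckT D = true)
    (h3 : c.poissonCheckP D = true) (h4 : c.tailCheckIM D = true) (h5 : c.tailCheckIB D = true)
    (a : Fin D → ℕ) (ha : List.ofFn a = unroll c.cls) (n : ℕ) (hn1 : 1 ≤ n) (hn4 : n ≤ 4) :
    ((c.lo n : ℚ) : ℝ)
        ≤ ((n - 1) ! : ℝ)⁻¹ * (∫ τ in Ioi (0:ℝ), τ ^ (n - 1) * (Real.exp (-τ) *
            (∏ μ, ∑ j ∈ Finset.range (c.J + 1), (if j = 0 then (1 : ℂ) else 2) *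
              ((∑ s ∈ Finset.range (a μ + 1), (((a μ).choose s : ℂ) / 2 ^ (a μ)) *
                (besselI (j * (c.m : ℤ) - ((2 * (s : ℤ) - (a μ : ℕ) : ℤ))) (τ / D) : ℂ)) * c.cT j)).re))
          / (2 * π) ^ D ∧
      ((n - 1) ! : ℝ)⁻¹ * (∫ τ in Ioi (0:ℝ), τ ^ (n - 1) * (Real.exp (-τ) *
            (∏ μ, ∑ j ∈ Finset.range (c.J + 1), (if j = 0 then (1 : ℂ) else 2) *
              ((∑ s ∈ Finset.range (a μ + 1), (((a μ).choose s : ℂ) / 2 ^ (a μ)) *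
                (besselI (j * (c.m : ℤ) - ((2 * (s : ℤ) - (a μ : ℕ) : ℤ))) (τ / D) : ℂ)) * c.cT j)).re))
          / (2 * π) ^ D
        ≤ ((c.hi n : ℚ) : ℝ) :=
  c.soundP D (c.checkP_intro D h1 h2 h3 h4 h5) a ha n hn1 hn4

end PrCert

end TailBlock2


end Literature.Probability.FitznerVanDerHofstad2017.SeedCert
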